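import Summits.AtomisticToContinuum.BoseEinsteinCondensation.Theses.BECSwapNoCatastrophe
import Summits.AtomisticToContinuum.BoseEinsteinCondensation.Theorems.BECSwapNoCatastropheTorusHalfSwapOverlapChordOfPath
import Summits.AtomisticToContinuum.BoseEinsteinCondensation.Theorems.BECSwapNoCatastropheTorusHalfSwapOverlapSwapInvariance
import Summits.AtomisticToContinuum.BoseEinsteinCondensation.Theorems.BECSwapNoCatastropheTorusHalfSwapOverlapSymmetricInfimum
import Summits.AtomisticToContinuum.BoseEinsteinCondensation.Theorems.BECSwapNoCatastropheTorusHalfSwapOverlapProductUpper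
import Summits.AtomisticToContinuum.BoseEinsteinCondensation.Theorems.BECSwapNoCatastropheTorusHalfSwapOverlapProductLower
import Summits.AtomisticToContinuum.BoseEinsteinCondensation.Theorems.BECSwapNoCatastropheTorusHalfSwapOverlapCruxOfChord
import Summits.AtomisticToContinuum.BoseEinsteinCondensation.Theorems.BECSwapNoCatastropheTorusHalfSwapOverlapHardCoreReduction
import Summits.AtomisticToContinuum.BoseEinsteinCondensation.Theorems.BECSwapNoCatastropheTorusHalfSwapOverlapAppendEmbedding
import Summits.AtomisticToContinuum.BoseEinsteinCondensation.Theorems.BECSwapNoCatastropheTorusHalfSwapOverlapNonVacuity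
import Summits.AtomisticToContinuum.BoseEinsteinCondensation.Theorems.BECSwapNoCatastropheDefs
import Summits.AtomisticToContinuum.BoseEinsteinCondensation.Theorems.BECSwapNoCatastropheTorusHalfSwapOverlapLowerFrame
import Summits.AtomisticToContinuum.BoseEinsteinCondensation.Theorems.BECSwapNoCatastropheTorusHalfSwapOverlapIntegrableSingularChord
import Summits.AtomisticToContinuum.BoseEinsteinCondensation.Theorems.BECSwapNoCatastropheTorusHalfSwapOverlapUpperFrameIntegrable
import Summits.AtomisticToContinuum.BoseEinsteinCondensation.Theorems.BECSwapNoCatastropheTorusHalfSwapOverlapHardCorePacking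
import Summits.AtomisticToContinuum.BoseEinsteinCondensation.Theorems.BECSwapNoCatastropheTorusHalfSwapOverlapTwoCopyIMS
import Summits.AtomisticToContinuum.BoseEinsteinCondensation.Theorems.BECSwapNoCatastropheTorusHalfSwapOverlapUpperFrameHardCore

/-!
# Birth skeleton for crux `TorusHalfSwapOverlap` (stmt-AtomisticToContinuum-14393) — lead c3 reshape (7 stubs), lead c5 v5 (non-vacuity cut out: 4 open/registered stubs)

Route `BECSwapNoCatastrophe` (sub-problem `BoseEinsteinCondensation`), crux rank 2:
THE HALF-SWAPPED TORUS GROUND STATE REMEMBERS THE PRODUCT — for every repulsive finite-range `v`,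
at small density and for all large `N = n + 1`, every `F`-symmetric periodic `C¹` `δ`-near-minimiser
`Θ` of the two-copy half-swapped torus form `E2(½)` and every periodic `δ`-near-minimiser `Ψ` of the
one-copy energy satisfy `|⟨Θ, Ψ ⊗ Ψ⟩_{cell²}|² ≥ ½ + η`.

## The line `birth` (the route's own two-layer plan, typed), reshaped by lead c3 into 7 registered stubs

The planner's 4 stubs (`boundedChord`, `singularChord`, `symmetricInfimum`, `productNearMinimiser`)
are kept as a COMPOSITION IDEA and cut at their natural seams so that independent workers can land them:

* `stub_pathRigidity` (**external, = the route's rank-3 item stmt-AtomisticToContinuum-14394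
  `TorusSwapPathRigidity` BY NAME; XL / open-problem**) — no orthogonality catastrophe along the torus
  swap path for bounded `v`. Nobody in this line proves it; the line is `blocked-on` it for regular `v`.
* `stub_chordOfPath` (**M, glue**) — `TorusSwapPathRigidity → BoundedChord`: the `(s, s′) = (½, 0)`,
  `ε = 1`, `τ = ⅛` instance of rank 3 after the pointwise identification of the inlined forms
  (`E2(0)`: `ofReal 1 · direct + ofReal 0 · cross` and `periodicInteraction (tail X) + ∑ⱼ v^per(x₀ − xⱼ₊₁)
  = periodicInteraction X` (`periodicInteraction_succ`); `E2(½)`: `ofReal ½ = 2⁻¹`, `mul_add`);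
  `1 − ¼ − ⅛ = ½ + ⅛`.
* `stub_singularChord` (**XL; the load for singular `v`, held by the lead**) — the chord claim for
  UNBOUNDED finite-range `v` (hard cores), where the path is degenerate (`½ · ⊤ = ⊤`).
* `stub_swapInvariance` (**M, fixed `n`**) — the one-pair swap `F (X, Y) = (y₀ :: X̂, x₀ :: Ŷ)` preserves
  the absolute class `Adm0` and the half-swapped form: `Θ ∘ F ∈ Adm0`, `E2(½)(Θ ∘ F) = E2(½)(Θ)`
  (`F` permutes the kinetic summands, fixes the weight and `cell²`, preserves Lebesgue measure — glue
  coordinates `exists_measurableEquiv_twoCopy` of `Theorems/BECSwapNoCatastropheMidpointLemmaTwoCopy`).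
* `stub_symmetricInfimum` (**L, fixed `n`, all `v` incl. hard cores**) — `SwapInvariance →` "F-symmetric
  infimum = absolute infimum for `E2(½)`" at EVERY `n, L`: parallelogram law for `Θ ± Θ∘F`
  (`q(g₊) + q(g₋) = 2q(Θ) + 2q(Θ∘F) = 4 q(Θ)`, `‖g₊‖² + ‖g₋‖² = 4`), and on the antisymmetric branch the
  diamagnetic inequality for the smoothed modulus `√(|g₋|² + ε²) − ε` (`F`-symmetric, `C¹`, periodic,
  `≤ |g₋|`, kinetic density `≤ |∇g₋|²`; `sqrtReg` calculus of `Literature…BosonicFloorSymmetrisation`).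
* `stub_productUpper` (**M, fixed `n`**) — for every periodic trial state `Ψ`, `Ψ ⊗ Ψ ∈ Adm0` and
  `E2(0)(Ψ ⊗ Ψ) ≤ 2 · periodicEnergy v Ψ` (product rule `|∇_X(Ψ⊗Ψ)|² = |Ψ(Y)|²|∇Ψ(X)|²`, Tonelli
  `lintegral_prod_mul`, `Measure.prod_restrict`, `Ψ.norm_eq`).
* `stub_productLower` (**M/L, fixed `n`**) — for every `Θ ∈ Adm0`, `2 · E₀^per(n+1, L) ≤ E2(0)(Θ)`
  (slicing: `E2(0) ≥ ∫_Y q₁(Θ(·,Y)) dY + ∫_X q₁(Θ(X,·)) dX`, `q₁(f) ≥ E₀^per ‖f‖²` for `C¹` periodic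
  slices by the homogeneous form of `periodicGroundStateEnergy_le_lintegral_of_periodic`
  (`Literature…BosonicFloor`: bosonic = absolute infimum, no Perron–Frobenius), Tonelli).

`TorusHalfSwapOverlap_of` (sorry-free) assembles them: chord claim for all `v` by cases on
boundedness (`chordOfPath pathRigidity` / `singularChord`), `δ := δ₁/2`; the crux's `Θ ∈ AdmSym ⊆ Adm0`
has `E2(½) Θ ≤ inf_AdmSym + δ = inf_{Adm0} + δ ≤ inf_{Adm0} + δ₁` (`symmetricInfimum swapInvariance`);
`Ψ ⊗ Ψ ∈ Adm0` with `E2(0)(Ψ⊗Ψ) ≤ 2 periodicEnergy ≤ 2E₀ + δ₁ ≤ inf_{Adm0} E2(0) + δ₁`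
(`productUpper`, `productLower`); the chord fires. `torusHalfSwapOverlap_iff` certifies (`Iff.rfl`) that
the vocabulary is the crux's inlined `let`s, and §2b certifies (`Iff.rfl`) the UNFOLDED tree-vocabulary
forms the workers' Theorems files prove (they cannot import this workfile).

Disproof used: none on file for this crux (`ledger crux ls stmt-AtomisticToContinuum-14393`: no
`Disproof.lean`, no Negative lemmas, 2026-08-17T06:50Z; re-checked 2026-08-17T11:00Z by lead c5). Dead lines: none
registered. The retired Dirichlet twin (stmt-3895, surface binding at `s = ½`) is avoided by construction: everything
lives on the torus.

## v5 (lead c5, 2026-08-17): the NON-VACUITY of the near-minimiser frames is cut out of the hard-core stub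

Every proof of the hard-core chord must show that, at small density and for all large `n`, the `Adm0`/`AdmSym` infima
of `E2(½)` and `E2(0)` are FINITE (otherwise every admissible function is a `δ`-near-minimiser and the overlap claim
is false — this is also the first thing a disprover checks). That fixed-`n` fact is provable now and is registered as
two stubs: `stub_appendEmbedding` (S5a: a `2(n+1)`-particle periodic trial state `Ξ`, read as the two-copy function
`Θ (X, Y) = Ξ (Fin.append X Y)`, lies in `Adm0` with `E2(½)(Θ) ≤ periodicEnergy v Ξ` and `E2(0)(Θ) ≤ periodicEnergy v Ξ`
— the two-copy weights are sub-sums of the full pair interaction of `2(n+1)` particles) and `stub_nonVacuity` (S5b: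
S5a + Ruelle finiteness of the torus energies at density `2ρ`, tree lemma
`Literature.Barriers.AtomisticToContinuum.BoseGas.exists_eventually_periodicGroundStateEnergy_lt_top`, with
`sideLength (2ρ) (2(n+1)) = sideLength ρ (n+1)` ⇒ all four frames finite eventually). The open stub becomes
`stub_hardCoreChordOfFrames : Frames → (hard-core chord)` (conclusion verbatim the v4 `stub_hardCoreChord`), and the
composition is `torusHalfSwapOverlap_of_pathRigidity_of_hardCoreChord h0 (hHC (hB hA))`.

## v6 (lead c6, 2026-08-17): the frames are ORDERED and (for integrable `v`) `O(ρ)`-TIGHT; the open hard-core chord is split by integrability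

Two more fixed-`n` frame facts that every chord/AOC argument uses are cut out and registered, in the FOLDED tree vocabulary
`TwoCopyTorus` of Theorems/BECSwapNoCatastropheDefs.lean (no `let`s in registered signatures):
`stub_lowerFrame` (S6a, M: `2·E₀^per(n+1,L) ≤ E2(½)(Θ)` on `Adm0`, all `v` incl. hard cores — the half-swapped integrand is the
average of the `E2(0)`-integrands of `Θ` and `Θ ∘ F`) and `stub_upperFrameIntegrable` (S6b, L: `inf_{Adm0} E2(½) ≤ 2E₀^per +
n L⁻³ ∫_{ℝ³} v` — the half-swap defect costs at most first-order perturbation theory, UNIFORMLY IN `n`, by translation-averaging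
the product of a near-minimiser with its translate). With the landed S3a/S3b/S5b they give `framesV6` (sorry-free here):
eventually in `n`, `E₀^per < ⊤`, `inf_{AdmSym} E2(½) = inf_{Adm0} E2(½) < ⊤`, `inf_{Adm0} E2(0) = 2E₀^per ≤ inf_{Adm0} E2(½)
≤ 2E₀^per + ρ‖v‖₁`. The open content `stub_hardCoreChordOfFrames` (profiles unbounded on `[0,∞)`) is SPLIT BY INTEGRABILITY
into the two physically distinct regimes: the INTEGRABLE singular class (`∫ v < ∞`, non-degenerate path) is reduced by the glue
`stub_integrableSingularChord` (S1e, M) to `stub_pathRigidityOfIntegrable` (S0′: rank 3 VERBATIM with boundedness replaced by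
integrability — the planner's natural repair is to restate stmt-14394 so), and the NON-INTEGRABLE class (`∫ v = ∞`, hard cores — the
degenerate path `½·⊤ = ⊤`, the route's foreseen child `HardCoreHalfSwap`) is `stub_nonIntegrableChord` (S1f), stated GIVEN `framesV6`.
Composition: `TorusHalfSwapOverlap_of h0 hUF hPI hI hN := torusHalfSwapOverlap_of_pathRigidity_of_hardCoreChord h0 (hardCoreChord_of …)`.
So the crux is closed modulo exactly THREE open statements, each a named planner action: stmt-14394 (bounded `v`), its integrable
restatement S0′, and the hard-core child S1f.
-/

noncomputable section

open MeasureTheory Filter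
open scoped ENNReal NNReal BigOperators ComplexConjugate

namespace Summit.AtomisticToContinuum.BoseEinsteinCondensation.Cruxes.TorusHalfSwapOverlap.Birth

open Literature.MathematicalPhysics.QuantumManyBody.BoseGas
open Summit.AtomisticToContinuum.BoseEinsteinCondensation.Theses.BECSwapNoCatastrophe
  (TorusHalfSwapOverlap TorusSwapPathRigidity)

/-! ## §1 Vocabulary: the two-copy torus (verbatim the crux's inlined `let`s) -/

/-- Two-copy configurations `(X, Y) ∈ (ℝ³)^{n+1} × (ℝ³)^{n+1}`; tagged particles `a = X 0`, `b = Y 0`. -/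
abbrev Config2 (n : ℕ) : Type := Config (n + 1) × Config (n + 1)

/-- The two-copy fundamental cell `[0,L)^{3(n+1)} × [0,L)^{3(n+1)}`. -/
def cell2 (n : ℕ) (L : ℝ) : Set (Config2 n) :=
  (cellN (n + 1) L) ×ˢ (cellN (n + 1) L)

/-- The one-pair swap `F (X, Y) = (y₀ :: X̂, x₀ :: Ŷ)` exchanging the tagged particles of the two copies. -/
def swapF (n : ℕ) (Z : Config2 n) : Config2 n :=
  (Matrix.vecCons (Z.2 0) (Fin.tail Z.1), Matrix.vecCons (Z.1 0) (Fin.tail Z.2))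

/-- Total kinetic density of both copies. -/
def kinetic2 (n : ℕ) (Θ : Config2 n → ℂ) (Z : Config2 n) : ℝ≥0∞ :=
  kineticDensity (fun X => Θ (X, Z.2)) Z.1 + kineticDensity (fun Y => Θ (Z.1, Y)) Z.2

/-- The HALF-SWAPPED interaction weight (`s = ½`): bath–bath interactions inside each copy, and each
tagged particle coupled at half strength to both baths (`½ · ⊤ = ⊤`). -/
def halfSwapWeight (v : ℝ → ℝ≥0∞) (n : ℕ) (L : ℝ) (Z : Config2 n) : ℝ≥0∞ :=
  periodicInteraction v L (Fin.tail Z.1) + periodicInteraction v L (Fin.tail Z.2) +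
    ∑ j : Fin n, (2 : ENNReal)⁻¹ * (periodizedPotential v L (Z.1 0 - Z.1 j.succ) +
      periodizedPotential v L (Z.2 0 - Z.2 j.succ) + periodizedPotential v L (Z.2 0 - Z.1 j.succ) +
      periodizedPotential v L (Z.1 0 - Z.2 j.succ))

/-- The half-swapped two-copy periodic quadratic form `E2(½)(Θ) = ∫_{cell²} |∇_X Θ|² + |∇_Y Θ|² + w_½ |Θ|²`
(verbatim the crux's `E2`; see `E2half_eq`). -/
def E2half (v : ℝ → ℝ≥0∞) (n : ℕ) (L : ℝ) (Θ : Config2 n → ℂ) : ℝ≥0∞ :=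
  ∫⁻ Z in cell2 n L, (kineticDensity (fun X => Θ (X, Z.2)) Z.1 + kineticDensity (fun Y => Θ (Z.1, Y)) Z.2 +
    (periodicInteraction v L (Fin.tail Z.1) + periodicInteraction v L (Fin.tail Z.2) +
      ∑ j : Fin n, (2 : ENNReal)⁻¹ * (periodizedPotential v L (Z.1 0 - Z.1 j.succ) +
        periodizedPotential v L (Z.2 0 - Z.2 j.succ) + periodizedPotential v L (Z.2 0 - Z.1 j.succ) +
        periodizedPotential v L (Z.1 0 - Z.2 j.succ))) * (‖Θ Z‖₊ : ENNReal) ^ 2)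

/-- `E2(½)` is "kinetic density of both copies + half-swapped weight × |Θ|²" (by `rfl`). -/
theorem E2half_eq (v : ℝ → ℝ≥0∞) (n : ℕ) (L : ℝ) (Θ : Config2 n → ℂ) :
    E2half v n L Θ = ∫⁻ Z in cell2 n L, kinetic2 n Θ Z + halfSwapWeight v n L Z * (‖Θ Z‖₊ : ENNReal) ^ 2 :=
  rfl

/-- The UNCOUPLED two-copy periodic quadratic form `E2(0)(Θ) = ∫_{cell²} |∇_X Θ|² + |∇_Y Θ|² +
(∑_{i<j} v^per(xᵢ-xⱼ) + ∑_{i<j} v^per(yᵢ-yⱼ)) |Θ|²` (the form of `H ⊕ H = H ⊗ 1 + 1 ⊗ H`). -/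
def E2zero (v : ℝ → ℝ≥0∞) (n : ℕ) (L : ℝ) (Θ : Config2 n → ℂ) : ℝ≥0∞ :=
  ∫⁻ Z in cell2 n L, kinetic2 n Θ Z + (periodicInteraction v L Z.1 + periodicInteraction v L Z.2) * (‖Θ Z‖₊ : ENNReal) ^ 2

/-- The route's swap-path form `E2(s)` (verbatim the `E2` of rank 3 `TorusSwapPathRigidity`): bath–bath
interactions plus `(1−s)[v^per(a−xⱼ) + v^per(b−yⱼ)] + s[v^per(b−xⱼ) + v^per(a−yⱼ)]`. -/
def E2path (v : ℝ → ℝ≥0∞) (n : ℕ) (L : ℝ) (s : ℝ) (Θ : Config2 n → ℂ) : ℝ≥0∞ :=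
  ∫⁻ Z in cell2 n L, (kineticDensity (fun X => Θ (X, Z.2)) Z.1 + kineticDensity (fun Y => Θ (Z.1, Y)) Z.2 +
    (periodicInteraction v L (Fin.tail Z.1) + periodicInteraction v L (Fin.tail Z.2) +
      ∑ j : Fin n, (ENNReal.ofReal (1 - s) * (periodizedPotential v L (Z.1 0 - Z.1 j.succ) +
        periodizedPotential v L (Z.2 0 - Z.2 j.succ)) + ENNReal.ofReal s *
          (periodizedPotential v L (Z.2 0 - Z.1 j.succ) + periodizedPotential v L (Z.1 0 - Z.2 j.succ)))) *
      (‖Θ Z‖₊ : ENNReal) ^ 2)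

/-- `Lℤ³`-periodicity in every particle coordinate of both copies (on generators). -/
def IsPeriodic2 (n : ℕ) (L : ℝ) (Θ : Config2 n → ℂ) : Prop :=
  ∀ (Z : Config2 n) (i : Fin (n + 1)) (k : Fin 3),
    Θ (Z.1 + Pi.single i (EuclideanSpace.single k L), Z.2) = Θ Z ∧
      Θ (Z.1, Z.2 + Pi.single i (EuclideanSpace.single k L)) = Θ Z

/-- Swap symmetry `Θ ∘ F = Θ`, `F : a = X 0 ↔ b = Y 0`. -/
def IsSwapSymmetric (n : ℕ) (Θ : Config2 n → ℂ) : Prop :=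
  ∀ X Y : Config (n + 1), Θ (Matrix.vecCons (Y 0) (Fin.tail X), Matrix.vecCons (X 0) (Fin.tail Y)) = Θ (X, Y)

/-- ABSOLUTE admissible class on `cell²`: `C¹`, periodic in both copies, normalised (no symmetry). -/
def Adm0 (n : ℕ) (L : ℝ) (Θ : Config2 n → ℂ) : Prop :=
  ContDiff ℝ 1 Θ ∧ IsPeriodic2 n L Θ ∧ ∫⁻ Z in cell2 n L, (‖Θ Z‖₊ : ENNReal) ^ 2 = 1

/-- The crux's admissible class: `Adm0` plus swap symmetry (conjuncts in the crux's order). -/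
def AdmSym (n : ℕ) (L : ℝ) (Θ : Config2 n → ℂ) : Prop :=
  ContDiff ℝ 1 Θ ∧ IsPeriodic2 n L Θ ∧ IsSwapSymmetric n Θ ∧ ∫⁻ Z in cell2 n L, (‖Θ Z‖₊ : ENNReal) ^ 2 = 1

/-- A swap-symmetric admissible function is absolutely admissible (forget the symmetry). [folklore] -/
theorem AdmSym.adm0 {n : ℕ} {L : ℝ} {Θ : Config2 n → ℂ} (h : AdmSym n L Θ) : Adm0 n L Θ :=
  ⟨h.1, h.2.1, h.2.2.2⟩

/-- The crux in this vocabulary — definitionally (`Iff.rfl`): the route decl's `let`s are exactly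
`cell2`, `E2half`, `AdmSym` at `L = sideLength ρ (n+1)`. -/
theorem torusHalfSwapOverlap_iff :
    TorusHalfSwapOverlap ↔
      ∀ v : ℝ → ℝ≥0∞, IsRepulsiveFiniteRange v → ∃ ρ₀ : ℝ, 0 < ρ₀ ∧ ∀ ρ : ℝ, 0 < ρ → ρ < ρ₀ →
        ∃ η : ℝ, 0 < η ∧ ∀ᶠ n : ℕ in atTop, ∃ δ : ℝ≥0∞, 0 < δ ∧
          ∀ Ψ : PeriodicTrialState (n + 1) (sideLength ρ (n + 1)),
            periodicEnergy v Ψ ≤ periodicGroundStateEnergy v (n + 1) (sideLength ρ (n + 1)) + δ →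
            ∀ Θ : Config2 n → ℂ, AdmSym n (sideLength ρ (n + 1)) Θ →
              E2half v n (sideLength ρ (n + 1)) Θ ≤
                (⨅ (Θ' : Config2 n → ℂ) (_ : AdmSym n (sideLength ρ (n + 1)) Θ'),
                  E2half v n (sideLength ρ (n + 1)) Θ') + δ →
              ENNReal.ofReal (1 / 2 + η) ≤
                (‖∫ Z in cell2 n (sideLength ρ (n + 1)), (starRingEnd ℂ) (Θ Z) * (Ψ.ψ Z.1 * Ψ.ψ Z.2)‖₊ :
                  ENNReal) ^ 2 :=
  Iff.rfl

/-- Rank 3 in this vocabulary — definitionally (`Iff.rfl`): its `let`s are `cell2`, `E2path`, `Adm0`. -/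
theorem torusSwapPathRigidity_iff :
    TorusSwapPathRigidity ↔
      ∀ v : ℝ → ℝ≥0∞, IsRepulsiveFiniteRange v → (∃ M : NNReal, ∀ r, v r ≤ M) → ∀ ε : ℝ, 0 < ε →
        ∃ ρ₀ : ℝ, 0 < ρ₀ ∧ ∀ ρ : ℝ, 0 < ρ → ρ < ρ₀ → ∀ᶠ n : ℕ in atTop,
          ∀ s : ℝ, 0 ≤ s → s ≤ 1 → ∀ s' : ℝ, 0 ≤ s' → s' ≤ 1 → ∀ τ : ℝ, 0 < τ → ∃ δ : ℝ≥0∞, 0 < δ ∧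
            ∀ Θ Θ' : Config2 n → ℂ, Adm0 n (sideLength ρ (n + 1)) Θ → Adm0 n (sideLength ρ (n + 1)) Θ' →
              E2path v n (sideLength ρ (n + 1)) s Θ ≤
                (⨅ (Θ'' : Config2 n → ℂ) (_ : Adm0 n (sideLength ρ (n + 1)) Θ''),
                  E2path v n (sideLength ρ (n + 1)) s Θ'') + δ →
              E2path v n (sideLength ρ (n + 1)) s' Θ' ≤
                (⨅ (Θ'' : Config2 n → ℂ) (_ : Adm0 n (sideLength ρ (n + 1)) Θ''),
                  E2path v n (sideLength ρ (n + 1)) s' Θ'') + δ →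
              ENNReal.ofReal (1 - ε * (s - s') ^ 2 - τ) ≤
                (‖∫ Z in cell2 n (sideLength ρ (n + 1)), (starRingEnd ℂ) (Θ Z) * Θ' Z‖₊ : ENNReal) ^ 2 :=
  Iff.rfl

/-! ## §2 The stub statements -/

/-- **The midpoint-chord overlap claim at a fixed potential `v`** (shared body of the chord stubs): there is
`ρ₀ > 0` such that for `0 < ρ < ρ₀` there is `η > 0` with, for all large `n` and some `δ > 0`: every
absolutely admissible `δ`-near-minimiser `Φ` of the uncoupled two-copy form `E2(0)` and every absolutely
admissible `δ`-near-minimiser `Θ` of the half-swapped form `E2(½)` on the torus of side `((n+1)/ρ)^{1/3}`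
satisfy `|⟨Θ, Φ⟩_{cell²}|² ≥ ½ + η`. Ground-state reading (Perron–Frobenius at fixed `n`):
`|⟨Φ(½), Ψ₀ ⊗ Ψ₀⟩|² ≥ ½ + η` UNIFORMLY IN `n` — the integrated no-orthogonality-catastrophe claim for the
chord `s = 0 → ½` of the swap path, with the product structure and the swap symmetry of the crux factored
out (they return through the fixed-`n` stubs). -/
def MidpointChordAt (v : ℝ → ℝ≥0∞) : Prop :=
  ∃ ρ₀ : ℝ, 0 < ρ₀ ∧ ∀ ρ : ℝ, 0 < ρ → ρ < ρ₀ →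
    ∃ η : ℝ, 0 < η ∧ ∀ᶠ n : ℕ in atTop, ∃ δ : ℝ≥0∞, 0 < δ ∧
      ∀ Φ Θ : Config2 n → ℂ,
        Adm0 n (sideLength ρ (n + 1)) Φ →
        E2zero v n (sideLength ρ (n + 1)) Φ ≤
          (⨅ (Θ' : Config2 n → ℂ) (_ : Adm0 n (sideLength ρ (n + 1)) Θ'), E2zero v n (sideLength ρ (n + 1)) Θ') + δ →
        Adm0 n (sideLength ρ (n + 1)) Θ →
        E2half v n (sideLength ρ (n + 1)) Θ ≤
          (⨅ (Θ' : Config2 n → ℂ) (_ : Adm0 n (sideLength ρ (n + 1)) Θ'), E2half v n (sideLength ρ (n + 1)) Θ') + δ →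
        ENNReal.ofReal (1 / 2 + η) ≤
          (‖∫ Z in cell2 n (sideLength ρ (n + 1)), (starRingEnd ℂ) (Θ Z) * Φ Z‖₊ : ENNReal) ^ 2

/-- **Chord claim for REGULAR potentials (XL / open-problem as a statement; reached here ONLY through
`stub_chordOfPath` from rank 3).** No orthogonality catastrophe across the half-swap chord, bounded
finite-range `v`: `(0, ½)` chord of `TorusSwapPathRigidity` (same absolute class `Adm0`). -/
def BoundedChord : Prop :=
  ∀ v : ℝ → ℝ≥0∞, IsRepulsiveFiniteRange v → (∃ M : NNReal, ∀ r, v r ≤ M) → MidpointChordAt v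

/-- **Stub (M, glue): rank 3 ⇒ the bounded chord.** `TorusSwapPathRigidity → BoundedChord`: with `ε = 1`
take rank 3's `ρ₀`; `η = ⅛`; eventually in `n` use `(s, s′) = (½, 0)`, `τ = ⅛` and its `δ`; the forms agree
pointwise — `E2path v n L (1/2) = E2half v n L` (`ofReal (1 - 1/2) = ofReal (1/2) = 2⁻¹`, `mul_add`) and
`E2path v n L 0 = E2zero v n L` (`ofReal 1 = 1`, `ofReal 0 * _ = 0`, and `periodicInteraction_succ`:
`∑ⱼ v^per(x₀ − xⱼ₊₁) + periodicInteraction (tail X) = periodicInteraction X`, `Fin.tail = Matrix.vecTail`),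
hence so do the `Adm0`-infima — and `1 − 1·(½ − 0)² − ⅛ = ½ + ⅛`. Why it might fail: it cannot (pure
bookkeeping); the weight is carried by rank 3. Leans on: `periodicInteraction_succ`
(`Literature…PeriodicBoseGasTagged`), `ENNReal.ofReal` arithmetic. -/
def ChordOfPath : Prop :=
  TorusSwapPathRigidity → BoundedChord

/-- **Stub (XL; the load for SINGULAR potentials): the chord overlap for unbounded finite-range `v`** —
hard cores `v = ⊤` on `[0, a]` included, where the path is DEGENERATE (`½ · ⊤ = ⊤`: every `E2(s)`,
`0 < s < 1`, carries the full cross-core exclusion while `E2(0)` does not), so no differential argument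
exists and rank 3 does not apply as filed. Expected mechanisms: (i) positivity / Feynman–Kac for the
two-copy torus measure (the half-swapped ground state is a positive reweighting of `Ψ₀ ⊗ Ψ₀` off an
excluded set of relative volume `O(ρ a³)`); (ii) a core-RADIUS deformation `r_A(s) + r_B(s) ≤ a` keeping
the tagged impurity's scattering length `≤ a`; (iii) Dyson-lemma softening (LSSY2005 Lemma 2.5) to a
bounded nearest-neighbour potential with the same scattering length, then rank 3 for the softened forms
plus a variational comparison back. Why it might fail: an `O(1)` overlap deficit from the UV of the
half-coupled pair surviving `ρ → 0` (midpoint impurity energy `2μ` for hard cores) would break the `½`;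
near-minimiser-wise the claim has the strength of torus BEC for hard spheres. NOTE the hypothesis
`¬ ∃ M, ∀ r, v r ≤ M` quantifies over ALL `r : ℝ` (also `r < 0`, never evaluated), so this class also
contains potentials that are bounded on `[0, ∞)`. Leans on: LSSY2005 Lemma 2.5 (Dyson), Thm 2.4; nothing
in tree. -/
def SingularChord : Prop :=
  ∀ v : ℝ → ℝ≥0∞, IsRepulsiveFiniteRange v → (¬ ∃ M : NNReal, ∀ r, v r ≤ M) → MidpointChordAt v

/-- **Stub (M, fixed `n`): the one-pair swap preserves the absolute class and the half-swapped form.**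
For every `v`, `n`, `L` and every `Θ ∈ Adm0`: `Θ ∘ F ∈ Adm0` and `E2(½)(Θ ∘ F) = E2(½)(Θ)`, where
`F (X, Y) = (y₀ :: X̂, x₀ :: Ŷ)` (`swapF`). Why true: `Θ ∘ F` is `C¹` (`F` is a continuous linear map),
periodic (translating `x₀` in `F Z` translates `y₀`'s slot, etc.), and `∫_{cell²} |Θ ∘ F|² = ∫_{cell²} |Θ|²`
because `F` is a measure-preserving involution of Lebesgue measure mapping `cell²` onto itself (glue
coordinates `e : ((X̂, Ŷ), (x, y)) ↦ (x :: X̂, y :: Ŷ)` of `exists_measurableEquiv_twoCopy`, under which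
`F = e ∘ Prod.map id Prod.swap ∘ e⁻¹`); for the form, the half-swapped weight is `F`-invariant termwise
(`a ↔ b` exchanges `v^per(a − xⱼ) ↔ v^per(b − xⱼ)` and `v^per(b − yⱼ) ↔ v^per(a − yⱼ)`, tails fixed) and
the total kinetic density satisfies `kinetic2 (Θ ∘ F) Z = kinetic2 Θ (F Z)` (chain rule: the partial
derivative of `Θ ∘ F` at `Z` along particle `i` of copy 1, axis `k`, is the partial derivative of `Θ` at
`F Z` along the `F`-image direction — `F` permutes the `6(n+1)` coordinate directions), then change
variables `Z ↦ F Z` on `cell²` (`MeasurePreserving.lintegral_comp_emb`, no measurability of `v` needed).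
Leans on: Mathlib `fderiv` chain rule / `ContinuousLinearEquiv`, `MeasurePreserving`, `Measure.prod_restrict`,
`volume_preserving_piFinSuccAbove`; `exists_measurableEquiv_twoCopy` (Theorems, PROVED). -/
def SwapInvariance : Prop :=
  ∀ v : ℝ → ℝ≥0∞, IsRepulsiveFiniteRange v → ∀ (n : ℕ) (L : ℝ) (Θ : Config2 n → ℂ), Adm0 n L Θ →
    Adm0 n L (fun Z => Θ (swapF n Z)) ∧ E2half v n L (fun Z => Θ (swapF n Z)) = E2half v n L Θ

/-- **"F-symmetric infimum = absolute infimum" for the half-swapped form, at every `n` and `L`.** -/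
def SymmetricInfimumAll : Prop :=
  ∀ v : ℝ → ℝ≥0∞, IsRepulsiveFiniteRange v → ∀ (n : ℕ) (L : ℝ),
    (⨅ (Θ' : Config2 n → ℂ) (_ : AdmSym n L Θ'), E2half v n L Θ') =
      ⨅ (Θ' : Config2 n → ℂ) (_ : Adm0 n L Θ'), E2half v n L Θ'

/-- **Stub (L, fixed `n`, all `v` incl. hard cores): swap invariance ⇒ F-symmetric infimum = absolute
infimum.** `≥` is monotonicity of `iInf` (`AdmSym → Adm0`). `≤`: for `Θ ∈ Adm0` with `q(Θ) < ⊤`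
(`q = E2half v n L`) put `g± = Θ ± Θ∘F`; pointwise parallelogram identities for the kinetic density
(`fderiv` is additive; `|a+b|² + |a−b|² = 2|a|² + 2|b|²` in `ℂ`) and for `w|·|²` give
`q(g₊) + q(g₋) = 2q(Θ) + 2q(Θ∘F) = 4q(Θ)` (swap invariance) and `‖g₊‖² + ‖g₋‖² = 4`, so one branch
`g ≠ 0` has `q(g) ≤ q(Θ)‖g‖²` (if `g₊ = 0` then `g₋ = 2Θ` works with equality, and vice versa).
Branch `g₊`: swap-symmetric, `C¹`, periodic; normalise (`q(c g) = |c|² q(g)`). Branch `g₋`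
(antisymmetric, `g₋ ∘ F = −g₋`): replace by `h_ε = √(|g₋|² + ε²) − ε`, which IS swap-symmetric
(`|g₋ ∘ F| = |g₋|`), `C¹` (`contDiff_sqrtReg` with a one-element family), periodic, with
`|∇h_ε|² ≤ |∇g₋|²` (`nnnorm_fderiv_ofReal_sqrtReg_sq_le`) and `h_ε² ≤ |g₋|²`
(`nnnorm_ofReal_sqrtReg_sq_le`; so `⊤`-weights are respected), hence `q(h_ε) ≤ q(g₋)`, and
`‖h_ε‖² → ‖g₋‖²` (`tendsto_sqrtReg_sq` + dominated convergence, cf. `tendsto_lintegral_nnnorm_sqrtSym_sq`);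
so `inf_AdmSym ≤ q(h_ε)/‖h_ε‖² → q(g₋)/‖g₋‖² ≤ q(Θ)`. Near-minimiser form of Perron–Frobenius. Empty
classes (`L ≤ 0`) give `⊤ = ⊤`. Leans on: `Literature…BosonicFloorSymmetrisation` (`sqrtReg` calculus,
PROVED), `Literature…BosonicFloor` (pattern of `periodicGroundStateEnergy_le_lintegral_of_periodic`),
Mathlib `lintegral` monotonicity / dominated convergence. -/
def SymmetricInfimumOfInvariance : Prop :=
  SwapInvariance → SymmetricInfimumAll

/-- **Stub (M, fixed `n`): the product of a periodic trial state with itself is absolutely admissible and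
its uncoupled two-copy energy is at most twice the one-copy energy** (in truth: equal). For every `v`, `n`,
`L` and `Ψ : PeriodicTrialState (n+1) L`: `Ψ ⊗ Ψ ∈ Adm0` (`ContDiff.mul`, `Ψ.periodic`, and
`∫_{cell²} |Ψ(X)|²|Ψ(Y)|² = 1` by `Measure.prod_restrict` + `lintegral_prod_mul` + `Ψ.norm_eq`) and
`E2(0)(Ψ ⊗ Ψ) ≤ 2 · periodicEnergy v Ψ` (product rule: `fderiv ℝ (fun X => Ψ X * Ψ Y) X = Ψ Y • fderiv ℝ Ψ X`,
so `|∇_X(Ψ⊗Ψ)|²(X,Y) = |Ψ Y|² |∇Ψ|²(X)`; the integrand is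
`|Ψ Y|²(|∇Ψ|²(X) + V(X)|Ψ X|²) + |Ψ X|²(|∇Ψ|²(Y) + V(Y)|Ψ Y|²)`; Tonelli twice). Leans on:
`PeriodicTrialState` API, `measurable_kineticDensity`, Mathlib product-measure `lintegral` lemmas. -/
def ProductUpper : Prop :=
  ∀ v : ℝ → ℝ≥0∞, IsRepulsiveFiniteRange v → ∀ (n : ℕ) (L : ℝ) (Ψ : PeriodicTrialState (n + 1) L),
    Adm0 n L (fun Z => Ψ.ψ Z.1 * Ψ.ψ Z.2) ∧
      E2zero v n L (fun Z => Ψ.ψ Z.1 * Ψ.ψ Z.2) ≤ 2 * periodicEnergy v Ψ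

/-- **Stub (M/L, fixed `n`): the uncoupled two-copy form is bounded below by twice the bosonic ground-state
energy on the absolute class.** For every `v`, `n`, `L` and `Θ ∈ Adm0`: `2 E₀^per(n+1, L) ≤ E2(0)(Θ)`.
Why true: `E2(0)(Θ) ≥ ∫_Y q₁(Θ(·,Y)) dY + ∫_X q₁(Θ(X,·)) dX` (`le_lintegral_add`; Tonelli on
`cellN ×ˢ cellN` via `Measure.prod_restrict` / `lintegral_prod`, measurability of
`Z ↦ kineticDensity (fun X => Θ (X, Z.2)) Z.1 = ∑ ‖fderiv ℝ Θ Z (Pi.single i (e_k), 0)‖²` from continuity of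
`fderiv` of a `C¹` map), and for each slice `f = Θ(·, Y)` (`C¹`, periodic, `m = ∫_cell |f|² < ⊤`):
`q₁(f) ≥ E₀^per · m` — the homogeneous form of `periodicGroundStateEnergy_le_lintegral_of_periodic`
(BosonicFloor.lean: bosonic infimum ≤ form of ANY normalised periodic `C¹` function; rescale `f/√m`,
`kineticDensity (c • f) = |c|² kineticDensity f`; `m = 0` trivial); finally `∫_Y m_Y dY = ∫_{cell²}|Θ|² = 1`.
Leans on: `periodicGroundStateEnergy_le_lintegral_of_periodic` (PROVED), Mathlib Tonelli. -/
def ProductLower : Prop :=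
  ∀ v : ℝ → ℝ≥0∞, IsRepulsiveFiniteRange v → ∀ (n : ℕ) (L : ℝ) (Θ : Config2 n → ℂ), Adm0 n L Θ →
    2 * periodicGroundStateEnergy v (n + 1) L ≤ E2zero v n L Θ

/-- Both regimes together: the chord claim for every repulsive finite-range `v`. -/
theorem midpointChordAt_of (h1a : BoundedChord) (h1b : SingularChord) (v : ℝ → ℝ≥0∞)
    (hv : IsRepulsiveFiniteRange v) : MidpointChordAt v := by
  by_cases hb : ∃ M : NNReal, ∀ r, v r ≤ M
  · exact h1a v hv hb
  · exact h1b v hv hb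

/-! ## §3 Audit names of the stub statements, in TREE VOCABULARY

`h21_check_skeleton` admits a hypothesis of the composition iff its head constant's short name is a declared stub
(`Goal.stub_x` unfolds reducibly to the statement of `stub_x`). The registered obligations are stated with every
piece of §1 vocabulary INLINED as `let`s over `Literature…BoseGas` names (and the route decl `TorusSwapPathRigidity`
by name), so that a worker's `Theorems/…` file — which cannot import this `Cruxes/` workfile — proves the registered
signature VERBATIM under the same name `stub_x` in this namespace; `Goal.stub_x_iff` certifies (`Iff.rfl`) that each
is definitionally the folded statement of §2, through which the composition consumes it. -/

namespace Goal

/-- Registered statement of `stub_pathRigidity`: S0 — EXTERNAL: rank 3 `TorusSwapPathRigidity` = stmt-AtomisticToContinuum-14394 BY NAME (open-problem; nobody in this line proves it). -/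
abbrev stub_pathRigidity : Prop :=
  TorusSwapPathRigidity

/-- Registered statement of `stub_chordOfPath`: S1 — `ChordOfPath` unfolded (glue, M): rank 3 ⇒ the bounded chord; `(s,s′) = (½,0)`, `ε = 1`, `τ = ⅛`, forms identified pointwise (`periodicInteraction_succ`, `ofReal ½ = 2⁻¹`). -/
abbrev stub_chordOfPath : Prop :=
  TorusSwapPathRigidity →
    ∀ v : ℝ → ℝ≥0∞, IsRepulsiveFiniteRange v → (∃ M : NNReal, ∀ r, v r ≤ M) →
      ∃ ρ₀ : ℝ, 0 < ρ₀ ∧ ∀ ρ : ℝ, 0 < ρ → ρ < ρ₀ → ∃ η : ℝ, 0 < η ∧ ∀ᶠ n : ℕ in atTop,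
        let L : ℝ := sideLength ρ (n + 1)
        let C2 : Set (Config (n + 1) × Config (n + 1)) := (cellN (n + 1) L) ×ˢ (cellN (n + 1) L)
        let E2z : (Config (n + 1) × Config (n + 1) → ℂ) → ℝ≥0∞ := fun Θ => ∫⁻ Z in C2,
          kineticDensity (fun X => Θ (X, Z.2)) Z.1 + kineticDensity (fun Y => Θ (Z.1, Y)) Z.2 +
            (periodicInteraction v L Z.1 + periodicInteraction v L Z.2) * (‖Θ Z‖₊ : ENNReal) ^ 2
        let E2h : (Config (n + 1) × Config (n + 1) → ℂ) → ℝ≥0∞ := fun Θ => ∫⁻ Z in C2,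
          (kineticDensity (fun X => Θ (X, Z.2)) Z.1 + kineticDensity (fun Y => Θ (Z.1, Y)) Z.2 +
            (periodicInteraction v L (Fin.tail Z.1) + periodicInteraction v L (Fin.tail Z.2) +
              ∑ j : Fin n, (2 : ENNReal)⁻¹ * (periodizedPotential v L (Z.1 0 - Z.1 j.succ) +
                periodizedPotential v L (Z.2 0 - Z.2 j.succ) + periodizedPotential v L (Z.2 0 - Z.1 j.succ) +
                periodizedPotential v L (Z.1 0 - Z.2 j.succ))) * (‖Θ Z‖₊ : ENNReal) ^ 2)
        let Adm : (Config (n + 1) × Config (n + 1) → ℂ) → Prop := fun Θ => ContDiff ℝ 1 Θ ∧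
          (∀ (Z : Config (n + 1) × Config (n + 1)) (i : Fin (n + 1)) (k : Fin 3),
            Θ (Z.1 + Pi.single i (EuclideanSpace.single k L), Z.2) = Θ Z ∧
              Θ (Z.1, Z.2 + Pi.single i (EuclideanSpace.single k L)) = Θ Z) ∧
          ∫⁻ Z in C2, (‖Θ Z‖₊ : ENNReal) ^ 2 = 1
        ∃ δ : ℝ≥0∞, 0 < δ ∧ ∀ Φ Θ : Config (n + 1) × Config (n + 1) → ℂ,
          Adm Φ → E2z Φ ≤ (⨅ (Θ' : Config (n + 1) × Config (n + 1) → ℂ) (_ : Adm Θ'), E2z Θ') + δ →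
          Adm Θ → E2h Θ ≤ (⨅ (Θ' : Config (n + 1) × Config (n + 1) → ℂ) (_ : Adm Θ'), E2h Θ') + δ →
          ENNReal.ofReal (1 / 2 + η) ≤ (‖∫ Z in C2, (starRingEnd ℂ) (Θ Z) * Φ Z‖₊ : ENNReal) ^ 2

/-- Registered statement of `stub_singularChord`: S1b — `SingularChord` unfolded (XL; hard cores / unbounded `v`: degenerate path `½·⊤ = ⊤`; positivity or Dyson softening; held by the lead). -/
abbrev stub_singularChord : Prop :=
  ∀ v : ℝ → ℝ≥0∞, IsRepulsiveFiniteRange v → (¬ ∃ M : NNReal, ∀ r, v r ≤ M) →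
    ∃ ρ₀ : ℝ, 0 < ρ₀ ∧ ∀ ρ : ℝ, 0 < ρ → ρ < ρ₀ → ∃ η : ℝ, 0 < η ∧ ∀ᶠ n : ℕ in atTop,
      let L : ℝ := sideLength ρ (n + 1)
      let C2 : Set (Config (n + 1) × Config (n + 1)) := (cellN (n + 1) L) ×ˢ (cellN (n + 1) L)
      let E2z : (Config (n + 1) × Config (n + 1) → ℂ) → ℝ≥0∞ := fun Θ => ∫⁻ Z in C2,
        kineticDensity (fun X => Θ (X, Z.2)) Z.1 + kineticDensity (fun Y => Θ (Z.1, Y)) Z.2 +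
          (periodicInteraction v L Z.1 + periodicInteraction v L Z.2) * (‖Θ Z‖₊ : ENNReal) ^ 2
      let E2h : (Config (n + 1) × Config (n + 1) → ℂ) → ℝ≥0∞ := fun Θ => ∫⁻ Z in C2,
        (kineticDensity (fun X => Θ (X, Z.2)) Z.1 + kineticDensity (fun Y => Θ (Z.1, Y)) Z.2 +
          (periodicInteraction v L (Fin.tail Z.1) + periodicInteraction v L (Fin.tail Z.2) +
            ∑ j : Fin n, (2 : ENNReal)⁻¹ * (periodizedPotential v L (Z.1 0 - Z.1 j.succ) +
              periodizedPotential v L (Z.2 0 - Z.2 j.succ) + periodizedPotential v L (Z.2 0 - Z.1 j.succ) +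
              periodizedPotential v L (Z.1 0 - Z.2 j.succ))) * (‖Θ Z‖₊ : ENNReal) ^ 2)
      let Adm : (Config (n + 1) × Config (n + 1) → ℂ) → Prop := fun Θ => ContDiff ℝ 1 Θ ∧
        (∀ (Z : Config (n + 1) × Config (n + 1)) (i : Fin (n + 1)) (k : Fin 3),
          Θ (Z.1 + Pi.single i (EuclideanSpace.single k L), Z.2) = Θ Z ∧
            Θ (Z.1, Z.2 + Pi.single i (EuclideanSpace.single k L)) = Θ Z) ∧
        ∫⁻ Z in C2, (‖Θ Z‖₊ : ENNReal) ^ 2 = 1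
      ∃ δ : ℝ≥0∞, 0 < δ ∧ ∀ Φ Θ : Config (n + 1) × Config (n + 1) → ℂ,
        Adm Φ → E2z Φ ≤ (⨅ (Θ' : Config (n + 1) × Config (n + 1) → ℂ) (_ : Adm Θ'), E2z Θ') + δ →
        Adm Θ → E2h Θ ≤ (⨅ (Θ' : Config (n + 1) × Config (n + 1) → ℂ) (_ : Adm Θ'), E2h Θ') + δ →
        ENNReal.ofReal (1 / 2 + η) ≤ (‖∫ Z in C2, (starRingEnd ℂ) (Θ Z) * Φ Z‖₊ : ENNReal) ^ 2

/-- Registered statement of `stub_swapInvariance`: S2a — `SwapInvariance` unfolded (M): the one-pair swap preserves `Adm0` and `E2(½)`. -/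
abbrev stub_swapInvariance : Prop :=
  ∀ v : ℝ → ℝ≥0∞, IsRepulsiveFiniteRange v → ∀ (n : ℕ) (L : ℝ) (Θ : Config (n + 1) × Config (n + 1) → ℂ),
    let C2 : Set (Config (n + 1) × Config (n + 1)) := (cellN (n + 1) L) ×ˢ (cellN (n + 1) L)
    let E2h : (Config (n + 1) × Config (n + 1) → ℂ) → ℝ≥0∞ := fun Θ => ∫⁻ Z in C2,
        (kineticDensity (fun X => Θ (X, Z.2)) Z.1 + kineticDensity (fun Y => Θ (Z.1, Y)) Z.2 +
          (periodicInteraction v L (Fin.tail Z.1) + periodicInteraction v L (Fin.tail Z.2) +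
            ∑ j : Fin n, (2 : ENNReal)⁻¹ * (periodizedPotential v L (Z.1 0 - Z.1 j.succ) +
              periodizedPotential v L (Z.2 0 - Z.2 j.succ) + periodizedPotential v L (Z.2 0 - Z.1 j.succ) +
              periodizedPotential v L (Z.1 0 - Z.2 j.succ))) * (‖Θ Z‖₊ : ENNReal) ^ 2)
    let Adm : (Config (n + 1) × Config (n + 1) → ℂ) → Prop := fun Θ => ContDiff ℝ 1 Θ ∧
        (∀ (Z : Config (n + 1) × Config (n + 1)) (i : Fin (n + 1)) (k : Fin 3),
          Θ (Z.1 + Pi.single i (EuclideanSpace.single k L), Z.2) = Θ Z ∧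
            Θ (Z.1, Z.2 + Pi.single i (EuclideanSpace.single k L)) = Θ Z) ∧
        ∫⁻ Z in C2, (‖Θ Z‖₊ : ENNReal) ^ 2 = 1
    let ΘF : Config (n + 1) × Config (n + 1) → ℂ := fun Z =>
      Θ (Matrix.vecCons (Z.2 0) (Fin.tail Z.1), Matrix.vecCons (Z.1 0) (Fin.tail Z.2))
    Adm Θ → Adm ΘF ∧ E2h ΘF = E2h Θ

/-- Registered statement of `stub_symmetricInfimum`: S2b — `SymmetricInfimumOfInvariance` unfolded (L): swap invariance ⇒ F-symmetric infimum = absolute infimum, every `n`, `L` (parallelogram + `sqrtReg` smoothing). -/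
abbrev stub_symmetricInfimum : Prop :=
  (∀ v : ℝ → ℝ≥0∞, IsRepulsiveFiniteRange v → ∀ (n : ℕ) (L : ℝ) (Θ : Config (n + 1) × Config (n + 1) → ℂ),
    let C2 : Set (Config (n + 1) × Config (n + 1)) := (cellN (n + 1) L) ×ˢ (cellN (n + 1) L)
    let E2h : (Config (n + 1) × Config (n + 1) → ℂ) → ℝ≥0∞ := fun Θ => ∫⁻ Z in C2,
        (kineticDensity (fun X => Θ (X, Z.2)) Z.1 + kineticDensity (fun Y => Θ (Z.1, Y)) Z.2 +
          (periodicInteraction v L (Fin.tail Z.1) + periodicInteraction v L (Fin.tail Z.2) +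
            ∑ j : Fin n, (2 : ENNReal)⁻¹ * (periodizedPotential v L (Z.1 0 - Z.1 j.succ) +
              periodizedPotential v L (Z.2 0 - Z.2 j.succ) + periodizedPotential v L (Z.2 0 - Z.1 j.succ) +
              periodizedPotential v L (Z.1 0 - Z.2 j.succ))) * (‖Θ Z‖₊ : ENNReal) ^ 2)
    let Adm : (Config (n + 1) × Config (n + 1) → ℂ) → Prop := fun Θ => ContDiff ℝ 1 Θ ∧
        (∀ (Z : Config (n + 1) × Config (n + 1)) (i : Fin (n + 1)) (k : Fin 3),
          Θ (Z.1 + Pi.single i (EuclideanSpace.single k L), Z.2) = Θ Z ∧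
            Θ (Z.1, Z.2 + Pi.single i (EuclideanSpace.single k L)) = Θ Z) ∧
        ∫⁻ Z in C2, (‖Θ Z‖₊ : ENNReal) ^ 2 = 1
    let ΘF : Config (n + 1) × Config (n + 1) → ℂ := fun Z =>
      Θ (Matrix.vecCons (Z.2 0) (Fin.tail Z.1), Matrix.vecCons (Z.1 0) (Fin.tail Z.2))
    Adm Θ → Adm ΘF ∧ E2h ΘF = E2h Θ) →
    ∀ v : ℝ → ℝ≥0∞, IsRepulsiveFiniteRange v → ∀ (n : ℕ) (L : ℝ),
      let C2 : Set (Config (n + 1) × Config (n + 1)) := (cellN (n + 1) L) ×ˢ (cellN (n + 1) L)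
      let E2h : (Config (n + 1) × Config (n + 1) → ℂ) → ℝ≥0∞ := fun Θ => ∫⁻ Z in C2,
        (kineticDensity (fun X => Θ (X, Z.2)) Z.1 + kineticDensity (fun Y => Θ (Z.1, Y)) Z.2 +
          (periodicInteraction v L (Fin.tail Z.1) + periodicInteraction v L (Fin.tail Z.2) +
            ∑ j : Fin n, (2 : ENNReal)⁻¹ * (periodizedPotential v L (Z.1 0 - Z.1 j.succ) +
              periodizedPotential v L (Z.2 0 - Z.2 j.succ) + periodizedPotential v L (Z.2 0 - Z.1 j.succ) +
              periodizedPotential v L (Z.1 0 - Z.2 j.succ))) * (‖Θ Z‖₊ : ENNReal) ^ 2)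
      let Adm : (Config (n + 1) × Config (n + 1) → ℂ) → Prop := fun Θ => ContDiff ℝ 1 Θ ∧
        (∀ (Z : Config (n + 1) × Config (n + 1)) (i : Fin (n + 1)) (k : Fin 3),
          Θ (Z.1 + Pi.single i (EuclideanSpace.single k L), Z.2) = Θ Z ∧
            Θ (Z.1, Z.2 + Pi.single i (EuclideanSpace.single k L)) = Θ Z) ∧
        ∫⁻ Z in C2, (‖Θ Z‖₊ : ENNReal) ^ 2 = 1
      let AdmS : (Config (n + 1) × Config (n + 1) → ℂ) → Prop := fun Θ => ContDiff ℝ 1 Θ ∧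
        (∀ (Z : Config (n + 1) × Config (n + 1)) (i : Fin (n + 1)) (k : Fin 3),
          Θ (Z.1 + Pi.single i (EuclideanSpace.single k L), Z.2) = Θ Z ∧
            Θ (Z.1, Z.2 + Pi.single i (EuclideanSpace.single k L)) = Θ Z) ∧
        (∀ X Y : Config (n + 1), Θ (Matrix.vecCons (Y 0) (Fin.tail X), Matrix.vecCons (X 0) (Fin.tail Y)) = Θ (X, Y)) ∧
        ∫⁻ Z in C2, (‖Θ Z‖₊ : ENNReal) ^ 2 = 1
      (⨅ (Θ' : Config (n + 1) × Config (n + 1) → ℂ) (_ : AdmS Θ'), E2h Θ') =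
        ⨅ (Θ' : Config (n + 1) × Config (n + 1) → ℂ) (_ : Adm Θ'), E2h Θ'

/-- Registered statement of `stub_productUpper`: S3a — `ProductUpper` unfolded (M): `Ψ ⊗ Ψ ∈ Adm0` and `E2(0)(Ψ⊗Ψ) ≤ 2 · periodicEnergy v Ψ` (product rule + Tonelli). -/
abbrev stub_productUpper : Prop :=
  ∀ v : ℝ → ℝ≥0∞, IsRepulsiveFiniteRange v → ∀ (n : ℕ) (L : ℝ) (Ψ : PeriodicTrialState (n + 1) L),
    let C2 : Set (Config (n + 1) × Config (n + 1)) := (cellN (n + 1) L) ×ˢ (cellN (n + 1) L)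
    let E2z : (Config (n + 1) × Config (n + 1) → ℂ) → ℝ≥0∞ := fun Θ => ∫⁻ Z in C2,
        kineticDensity (fun X => Θ (X, Z.2)) Z.1 + kineticDensity (fun Y => Θ (Z.1, Y)) Z.2 +
          (periodicInteraction v L Z.1 + periodicInteraction v L Z.2) * (‖Θ Z‖₊ : ENNReal) ^ 2
    let Adm : (Config (n + 1) × Config (n + 1) → ℂ) → Prop := fun Θ => ContDiff ℝ 1 Θ ∧
        (∀ (Z : Config (n + 1) × Config (n + 1)) (i : Fin (n + 1)) (k : Fin 3),
          Θ (Z.1 + Pi.single i (EuclideanSpace.single k L), Z.2) = Θ Z ∧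
            Θ (Z.1, Z.2 + Pi.single i (EuclideanSpace.single k L)) = Θ Z) ∧
        ∫⁻ Z in C2, (‖Θ Z‖₊ : ENNReal) ^ 2 = 1
    Adm (fun Z => Ψ.ψ Z.1 * Ψ.ψ Z.2) ∧ E2z (fun Z => Ψ.ψ Z.1 * Ψ.ψ Z.2) ≤ 2 * periodicEnergy v Ψ

/-- Registered statement of `stub_productLower`: S3b — `ProductLower` unfolded (M/L): `2 E₀^per(n+1,L) ≤ E2(0)(Θ)` on `Adm0` (slicing + bosonic = absolute infimum). -/
abbrev stub_productLower : Prop :=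
  ∀ v : ℝ → ℝ≥0∞, IsRepulsiveFiniteRange v → ∀ (n : ℕ) (L : ℝ) (Θ : Config (n + 1) × Config (n + 1) → ℂ),
    let C2 : Set (Config (n + 1) × Config (n + 1)) := (cellN (n + 1) L) ×ˢ (cellN (n + 1) L)
    let E2z : (Config (n + 1) × Config (n + 1) → ℂ) → ℝ≥0∞ := fun Θ => ∫⁻ Z in C2,
        kineticDensity (fun X => Θ (X, Z.2)) Z.1 + kineticDensity (fun Y => Θ (Z.1, Y)) Z.2 +
          (periodicInteraction v L Z.1 + periodicInteraction v L Z.2) * (‖Θ Z‖₊ : ENNReal) ^ 2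
    let Adm : (Config (n + 1) × Config (n + 1) → ℂ) → Prop := fun Θ => ContDiff ℝ 1 Θ ∧
        (∀ (Z : Config (n + 1) × Config (n + 1)) (i : Fin (n + 1)) (k : Fin 3),
          Θ (Z.1 + Pi.single i (EuclideanSpace.single k L), Z.2) = Θ Z ∧
            Θ (Z.1, Z.2 + Pi.single i (EuclideanSpace.single k L)) = Θ Z) ∧
        ∫⁻ Z in C2, (‖Θ Z‖₊ : ENNReal) ^ 2 = 1
    Adm Θ → 2 * periodicGroundStateEnergy v (n + 1) L ≤ E2z Θ

/-- Registered statement of `stub_hardCoreChord`: S1c — the HARD-CORE chord (XL; replaces S1b: the midpoint-chord overlap claim for profiles UNBOUNDED ON `[0, ∞)`, hard cores `⊤·1_{[0,a]}` included; the route's foreseen child `HardCoreHalfSwap`). -/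
abbrev stub_hardCoreChord : Prop :=
  ∀ v : ℝ → ℝ≥0∞, IsRepulsiveFiniteRange v → (¬ ∃ M : NNReal, ∀ r, 0 ≤ r → v r ≤ M) →
    ∃ ρ₀ : ℝ, 0 < ρ₀ ∧ ∀ ρ : ℝ, 0 < ρ → ρ < ρ₀ → ∃ η : ℝ, 0 < η ∧ ∀ᶠ n : ℕ in atTop,
      let L : ℝ := sideLength ρ (n + 1)
      let C2 : Set (Config (n + 1) × Config (n + 1)) := (cellN (n + 1) L) ×ˢ (cellN (n + 1) L)
      let E2z : (Config (n + 1) × Config (n + 1) → ℂ) → ℝ≥0∞ := fun Θ => ∫⁻ Z in C2,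
        kineticDensity (fun X => Θ (X, Z.2)) Z.1 + kineticDensity (fun Y => Θ (Z.1, Y)) Z.2 +
          (periodicInteraction v L Z.1 + periodicInteraction v L Z.2) * (‖Θ Z‖₊ : ENNReal) ^ 2
      let E2h : (Config (n + 1) × Config (n + 1) → ℂ) → ℝ≥0∞ := fun Θ => ∫⁻ Z in C2,
        (kineticDensity (fun X => Θ (X, Z.2)) Z.1 + kineticDensity (fun Y => Θ (Z.1, Y)) Z.2 +
          (periodicInteraction v L (Fin.tail Z.1) + periodicInteraction v L (Fin.tail Z.2) +
            ∑ j : Fin n, (2 : ENNReal)⁻¹ * (periodizedPotential v L (Z.1 0 - Z.1 j.succ) +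
              periodizedPotential v L (Z.2 0 - Z.2 j.succ) + periodizedPotential v L (Z.2 0 - Z.1 j.succ) +
              periodizedPotential v L (Z.1 0 - Z.2 j.succ))) * (‖Θ Z‖₊ : ENNReal) ^ 2)
      let Adm : (Config (n + 1) × Config (n + 1) → ℂ) → Prop := fun Θ => ContDiff ℝ 1 Θ ∧
        (∀ (Z : Config (n + 1) × Config (n + 1)) (i : Fin (n + 1)) (k : Fin 3),
          Θ (Z.1 + Pi.single i (EuclideanSpace.single k L), Z.2) = Θ Z ∧
            Θ (Z.1, Z.2 + Pi.single i (EuclideanSpace.single k L)) = Θ Z) ∧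
        ∫⁻ Z in C2, (‖Θ Z‖₊ : ENNReal) ^ 2 = 1
      ∃ δ : ℝ≥0∞, 0 < δ ∧ ∀ Φ Θ : Config (n + 1) × Config (n + 1) → ℂ,
        Adm Φ → E2z Φ ≤ (⨅ (Θ' : Config (n + 1) × Config (n + 1) → ℂ) (_ : Adm Θ'), E2z Θ') + δ →
        Adm Θ → E2h Θ ≤ (⨅ (Θ' : Config (n + 1) × Config (n + 1) → ℂ) (_ : Adm Θ'), E2h Θ') + δ →
        ENNReal.ofReal (1 / 2 + η) ≤ (‖∫ Z in C2, (starRingEnd ℂ) (Θ Z) * Φ Z‖₊ : ENNReal) ^ 2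

/-- Registered statement of `stub_singularOfHardCore`: S1d — glue (M): rank 3 + the hard-core chord ⇒ the singular chord S1b (truncate `v` to `[0,∞)`: same periodisation, bounded, admissible; lands as Theorems/…HardCoreReduction.lean). -/
abbrev stub_singularOfHardCore : Prop :=
  TorusSwapPathRigidity →
  (∀ v : ℝ → ℝ≥0∞, IsRepulsiveFiniteRange v → (¬ ∃ M : NNReal, ∀ r, 0 ≤ r → v r ≤ M) →
    ∃ ρ₀ : ℝ, 0 < ρ₀ ∧ ∀ ρ : ℝ, 0 < ρ → ρ < ρ₀ → ∃ η : ℝ, 0 < η ∧ ∀ᶠ n : ℕ in atTop,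
      let L : ℝ := sideLength ρ (n + 1)
      let C2 : Set (Config (n + 1) × Config (n + 1)) := (cellN (n + 1) L) ×ˢ (cellN (n + 1) L)
      let E2z : (Config (n + 1) × Config (n + 1) → ℂ) → ℝ≥0∞ := fun Θ => ∫⁻ Z in C2,
        kineticDensity (fun X => Θ (X, Z.2)) Z.1 + kineticDensity (fun Y => Θ (Z.1, Y)) Z.2 +
          (periodicInteraction v L Z.1 + periodicInteraction v L Z.2) * (‖Θ Z‖₊ : ENNReal) ^ 2
      let E2h : (Config (n + 1) × Config (n + 1) → ℂ) → ℝ≥0∞ := fun Θ => ∫⁻ Z in C2,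
        (kineticDensity (fun X => Θ (X, Z.2)) Z.1 + kineticDensity (fun Y => Θ (Z.1, Y)) Z.2 +
          (periodicInteraction v L (Fin.tail Z.1) + periodicInteraction v L (Fin.tail Z.2) +
            ∑ j : Fin n, (2 : ENNReal)⁻¹ * (periodizedPotential v L (Z.1 0 - Z.1 j.succ) +
              periodizedPotential v L (Z.2 0 - Z.2 j.succ) + periodizedPotential v L (Z.2 0 - Z.1 j.succ) +
              periodizedPotential v L (Z.1 0 - Z.2 j.succ))) * (‖Θ Z‖₊ : ENNReal) ^ 2)
      let Adm : (Config (n + 1) × Config (n + 1) → ℂ) → Prop := fun Θ => ContDiff ℝ 1 Θ ∧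
        (∀ (Z : Config (n + 1) × Config (n + 1)) (i : Fin (n + 1)) (k : Fin 3),
          Θ (Z.1 + Pi.single i (EuclideanSpace.single k L), Z.2) = Θ Z ∧
            Θ (Z.1, Z.2 + Pi.single i (EuclideanSpace.single k L)) = Θ Z) ∧
        ∫⁻ Z in C2, (‖Θ Z‖₊ : ENNReal) ^ 2 = 1
      ∃ δ : ℝ≥0∞, 0 < δ ∧ ∀ Φ Θ : Config (n + 1) × Config (n + 1) → ℂ,
        Adm Φ → E2z Φ ≤ (⨅ (Θ' : Config (n + 1) × Config (n + 1) → ℂ) (_ : Adm Θ'), E2z Θ') + δ →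
        Adm Θ → E2h Θ ≤ (⨅ (Θ' : Config (n + 1) × Config (n + 1) → ℂ) (_ : Adm Θ'), E2h Θ') + δ →
        ENNReal.ofReal (1 / 2 + η) ≤ (‖∫ Z in C2, (starRingEnd ℂ) (Θ Z) * Φ Z‖₊ : ENNReal) ^ 2) →
  ∀ v : ℝ → ℝ≥0∞, IsRepulsiveFiniteRange v → (¬ ∃ M : NNReal, ∀ r, v r ≤ M) →
    ∃ ρ₀ : ℝ, 0 < ρ₀ ∧ ∀ ρ : ℝ, 0 < ρ → ρ < ρ₀ → ∃ η : ℝ, 0 < η ∧ ∀ᶠ n : ℕ in atTop,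
      let L : ℝ := sideLength ρ (n + 1)
      let C2 : Set (Config (n + 1) × Config (n + 1)) := (cellN (n + 1) L) ×ˢ (cellN (n + 1) L)
      let E2z : (Config (n + 1) × Config (n + 1) → ℂ) → ℝ≥0∞ := fun Θ => ∫⁻ Z in C2,
        kineticDensity (fun X => Θ (X, Z.2)) Z.1 + kineticDensity (fun Y => Θ (Z.1, Y)) Z.2 +
          (periodicInteraction v L Z.1 + periodicInteraction v L Z.2) * (‖Θ Z‖₊ : ENNReal) ^ 2
      let E2h : (Config (n + 1) × Config (n + 1) → ℂ) → ℝ≥0∞ := fun Θ => ∫⁻ Z in C2,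
        (kineticDensity (fun X => Θ (X, Z.2)) Z.1 + kineticDensity (fun Y => Θ (Z.1, Y)) Z.2 +
          (periodicInteraction v L (Fin.tail Z.1) + periodicInteraction v L (Fin.tail Z.2) +
            ∑ j : Fin n, (2 : ENNReal)⁻¹ * (periodizedPotential v L (Z.1 0 - Z.1 j.succ) +
              periodizedPotential v L (Z.2 0 - Z.2 j.succ) + periodizedPotential v L (Z.2 0 - Z.1 j.succ) +
              periodizedPotential v L (Z.1 0 - Z.2 j.succ))) * (‖Θ Z‖₊ : ENNReal) ^ 2)
      let Adm : (Config (n + 1) × Config (n + 1) → ℂ) → Prop := fun Θ => ContDiff ℝ 1 Θ ∧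
        (∀ (Z : Config (n + 1) × Config (n + 1)) (i : Fin (n + 1)) (k : Fin 3),
          Θ (Z.1 + Pi.single i (EuclideanSpace.single k L), Z.2) = Θ Z ∧
            Θ (Z.1, Z.2 + Pi.single i (EuclideanSpace.single k L)) = Θ Z) ∧
        ∫⁻ Z in C2, (‖Θ Z‖₊ : ENNReal) ^ 2 = 1
      ∃ δ : ℝ≥0∞, 0 < δ ∧ ∀ Φ Θ : Config (n + 1) × Config (n + 1) → ℂ,
        Adm Φ → E2z Φ ≤ (⨅ (Θ' : Config (n + 1) × Config (n + 1) → ℂ) (_ : Adm Θ'), E2z Θ') + δ →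
        Adm Θ → E2h Θ ≤ (⨅ (Θ' : Config (n + 1) × Config (n + 1) → ℂ) (_ : Adm Θ'), E2h Θ') + δ →
        ENNReal.ofReal (1 / 2 + η) ≤ (‖∫ Z in C2, (starRingEnd ℂ) (Θ Z) * Φ Z‖₊ : ENNReal) ^ 2

/-- Registered statement of `stub_cruxOfChord`: S4 — the line's fixed-`n` COMPOSITION NODE "midpoint-chord overlap at `v` ⇒ the crux at `v`" (M; from the landed S2a/S2b/S3a/S3b; lands as Theorems/…CruxOfChord.lean). -/
abbrev stub_cruxOfChord : Prop :=
  ∀ v : ℝ → ℝ≥0∞, IsRepulsiveFiniteRange v →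
    (∃ ρ₀ : ℝ, 0 < ρ₀ ∧ ∀ ρ : ℝ, 0 < ρ → ρ < ρ₀ → ∃ η : ℝ, 0 < η ∧ ∀ᶠ n : ℕ in atTop,
      let L : ℝ := sideLength ρ (n + 1)
      let C2 : Set (Config (n + 1) × Config (n + 1)) := (cellN (n + 1) L) ×ˢ (cellN (n + 1) L)
      let E2z : (Config (n + 1) × Config (n + 1) → ℂ) → ℝ≥0∞ := fun Θ => ∫⁻ Z in C2,
        kineticDensity (fun X => Θ (X, Z.2)) Z.1 + kineticDensity (fun Y => Θ (Z.1, Y)) Z.2 +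
          (periodicInteraction v L Z.1 + periodicInteraction v L Z.2) * (‖Θ Z‖₊ : ENNReal) ^ 2
      let E2h : (Config (n + 1) × Config (n + 1) → ℂ) → ℝ≥0∞ := fun Θ => ∫⁻ Z in C2,
        (kineticDensity (fun X => Θ (X, Z.2)) Z.1 + kineticDensity (fun Y => Θ (Z.1, Y)) Z.2 +
          (periodicInteraction v L (Fin.tail Z.1) + periodicInteraction v L (Fin.tail Z.2) +
            ∑ j : Fin n, (2 : ENNReal)⁻¹ * (periodizedPotential v L (Z.1 0 - Z.1 j.succ) +
              periodizedPotential v L (Z.2 0 - Z.2 j.succ) + periodizedPotential v L (Z.2 0 - Z.1 j.succ) +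
              periodizedPotential v L (Z.1 0 - Z.2 j.succ))) * (‖Θ Z‖₊ : ENNReal) ^ 2)
      let Adm : (Config (n + 1) × Config (n + 1) → ℂ) → Prop := fun Θ => ContDiff ℝ 1 Θ ∧
        (∀ (Z : Config (n + 1) × Config (n + 1)) (i : Fin (n + 1)) (k : Fin 3),
          Θ (Z.1 + Pi.single i (EuclideanSpace.single k L), Z.2) = Θ Z ∧
            Θ (Z.1, Z.2 + Pi.single i (EuclideanSpace.single k L)) = Θ Z) ∧
        ∫⁻ Z in C2, (‖Θ Z‖₊ : ENNReal) ^ 2 = 1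
      ∃ δ : ℝ≥0∞, 0 < δ ∧ ∀ Φ Θ : Config (n + 1) × Config (n + 1) → ℂ,
        Adm Φ → E2z Φ ≤ (⨅ (Θ' : Config (n + 1) × Config (n + 1) → ℂ) (_ : Adm Θ'), E2z Θ') + δ →
        Adm Θ → E2h Θ ≤ (⨅ (Θ' : Config (n + 1) × Config (n + 1) → ℂ) (_ : Adm Θ'), E2h Θ') + δ →
        ENNReal.ofReal (1 / 2 + η) ≤ (‖∫ Z in C2, (starRingEnd ℂ) (Θ Z) * Φ Z‖₊ : ENNReal) ^ 2) →
    ∃ ρ₀ : ℝ, 0 < ρ₀ ∧ ∀ ρ : ℝ, 0 < ρ → ρ < ρ₀ → ∃ η : ℝ, 0 < η ∧ ∀ᶠ n : ℕ in atTop,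
        let L : ℝ := sideLength ρ (n + 1)
        let C2 : Set (Config (n + 1) × Config (n + 1)) := (cellN (n + 1) L) ×ˢ (cellN (n + 1) L)
        let E2h : (Config (n + 1) × Config (n + 1) → ℂ) → ℝ≥0∞ := fun Θ => ∫⁻ Z in C2,
          (kineticDensity (fun X => Θ (X, Z.2)) Z.1 + kineticDensity (fun Y => Θ (Z.1, Y)) Z.2 +
            (periodicInteraction v L (Fin.tail Z.1) + periodicInteraction v L (Fin.tail Z.2) +
              ∑ j : Fin n, (2 : ENNReal)⁻¹ * (periodizedPotential v L (Z.1 0 - Z.1 j.succ) +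
                periodizedPotential v L (Z.2 0 - Z.2 j.succ) + periodizedPotential v L (Z.2 0 - Z.1 j.succ) +
                periodizedPotential v L (Z.1 0 - Z.2 j.succ))) * (‖Θ Z‖₊ : ENNReal) ^ 2)
        let AdmS : (Config (n + 1) × Config (n + 1) → ℂ) → Prop := fun Θ => ContDiff ℝ 1 Θ ∧
          (∀ (Z : Config (n + 1) × Config (n + 1)) (i : Fin (n + 1)) (k : Fin 3),
            Θ (Z.1 + Pi.single i (EuclideanSpace.single k L), Z.2) = Θ Z ∧
              Θ (Z.1, Z.2 + Pi.single i (EuclideanSpace.single k L)) = Θ Z) ∧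
          (∀ X Y : Config (n + 1), Θ (Matrix.vecCons (Y 0) (Fin.tail X), Matrix.vecCons (X 0) (Fin.tail Y)) = Θ (X, Y)) ∧
          ∫⁻ Z in C2, (‖Θ Z‖₊ : ENNReal) ^ 2 = 1
        ∃ δ : ℝ≥0∞, 0 < δ ∧ ∀ Ψ : PeriodicTrialState (n + 1) L,
          periodicEnergy v Ψ ≤ periodicGroundStateEnergy v (n + 1) L + δ →
          ∀ Θ : Config (n + 1) × Config (n + 1) → ℂ, AdmS Θ →
            E2h Θ ≤ (⨅ (Θ' : Config (n + 1) × Config (n + 1) → ℂ) (_ : AdmS Θ'), E2h Θ') + δ →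
            ENNReal.ofReal (1 / 2 + η) ≤
              (‖∫ Z in C2, (starRingEnd ℂ) (Θ Z) * (Ψ.ψ Z.1 * Ψ.ψ Z.2)‖₊ : ENNReal) ^ 2

/-- Registered statement of `stub_appendEmbedding`: S5a — fixed-`n` EMBEDDING (M/L): a periodic `(n+1)+(n+1)`-particle
trial state `Ξ`, read as the two-copy function `Θ (X, Y) = Ξ (Fin.append X Y)`, is absolutely admissible on `cell²` and its
two-copy energies are at most its one-copy periodic energy (`kinetic2 Θ = kineticDensity Ξ ∘ append`, the half-swapped and the
uncoupled weights are SUB-sums of the full pair interaction of the `2(n+1)` particles, `Fin.append` is measure preserving and maps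
`cell²` onto `cellN (2(n+1))`). -/
abbrev stub_appendEmbedding : Prop :=
  ∀ v : ℝ → ℝ≥0∞, IsRepulsiveFiniteRange v → ∀ (n : ℕ) (L : ℝ) (Ξ : PeriodicTrialState ((n + 1) + (n + 1)) L),
    let C2 : Set (Config (n + 1) × Config (n + 1)) := (cellN (n + 1) L) ×ˢ (cellN (n + 1) L)
    let E2z : (Config (n + 1) × Config (n + 1) → ℂ) → ℝ≥0∞ := fun Θ => ∫⁻ Z in C2,
      kineticDensity (fun X => Θ (X, Z.2)) Z.1 + kineticDensity (fun Y => Θ (Z.1, Y)) Z.2 +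
        (periodicInteraction v L Z.1 + periodicInteraction v L Z.2) * (‖Θ Z‖₊ : ENNReal) ^ 2
    let E2h : (Config (n + 1) × Config (n + 1) → ℂ) → ℝ≥0∞ := fun Θ => ∫⁻ Z in C2,
      (kineticDensity (fun X => Θ (X, Z.2)) Z.1 + kineticDensity (fun Y => Θ (Z.1, Y)) Z.2 +
        (periodicInteraction v L (Fin.tail Z.1) + periodicInteraction v L (Fin.tail Z.2) +
          ∑ j : Fin n, (2 : ENNReal)⁻¹ * (periodizedPotential v L (Z.1 0 - Z.1 j.succ) +
            periodizedPotential v L (Z.2 0 - Z.2 j.succ) + periodizedPotential v L (Z.2 0 - Z.1 j.succ) +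
            periodizedPotential v L (Z.1 0 - Z.2 j.succ))) * (‖Θ Z‖₊ : ENNReal) ^ 2)
    let Adm : (Config (n + 1) × Config (n + 1) → ℂ) → Prop := fun Θ => ContDiff ℝ 1 Θ ∧
      (∀ (Z : Config (n + 1) × Config (n + 1)) (i : Fin (n + 1)) (k : Fin 3),
        Θ (Z.1 + Pi.single i (EuclideanSpace.single k L), Z.2) = Θ Z ∧
          Θ (Z.1, Z.2 + Pi.single i (EuclideanSpace.single k L)) = Θ Z) ∧
      ∫⁻ Z in C2, (‖Θ Z‖₊ : ENNReal) ^ 2 = 1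
    let Θ : Config (n + 1) × Config (n + 1) → ℂ := fun Z => Ξ.ψ (Fin.append Z.1 Z.2)
    Adm Θ ∧ E2h Θ ≤ periodicEnergy v Ξ ∧ E2z Θ ≤ periodicEnergy v Ξ

/-- Registered statement of `stub_nonVacuity`: S5b — NON-VACUITY OF THE NEAR-MINIMISER FRAMES (S/M): from S5a and Ruelle
finiteness of the torus energies at the double density (tree: `exists_eventually_periodicGroundStateEnergy_lt_top`, with
`sideLength (2ρ) (2(n+1)) = sideLength ρ (n+1)`), at small density and for all large `n` the `AdmSym`- and `Adm0`-infima of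
`E2(½)`, the `Adm0`-infimum of `E2(0)` and `E₀^per(n+1)` are all finite (the `AdmSym`-infimum through the landed
`stub_symmetricInfimum stub_swapInvariance`). Without this every admissible function would be a near-minimiser and the chord
claim false; every proof of the hard-core chord passes through it. -/
abbrev stub_nonVacuity : Prop :=
  (∀ v : ℝ → ℝ≥0∞, IsRepulsiveFiniteRange v → ∀ (n : ℕ) (L : ℝ) (Ξ : PeriodicTrialState ((n + 1) + (n + 1)) L),
    let C2 : Set (Config (n + 1) × Config (n + 1)) := (cellN (n + 1) L) ×ˢ (cellN (n + 1) L)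
    let E2z : (Config (n + 1) × Config (n + 1) → ℂ) → ℝ≥0∞ := fun Θ => ∫⁻ Z in C2,
      kineticDensity (fun X => Θ (X, Z.2)) Z.1 + kineticDensity (fun Y => Θ (Z.1, Y)) Z.2 +
        (periodicInteraction v L Z.1 + periodicInteraction v L Z.2) * (‖Θ Z‖₊ : ENNReal) ^ 2
    let E2h : (Config (n + 1) × Config (n + 1) → ℂ) → ℝ≥0∞ := fun Θ => ∫⁻ Z in C2,
      (kineticDensity (fun X => Θ (X, Z.2)) Z.1 + kineticDensity (fun Y => Θ (Z.1, Y)) Z.2 +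
        (periodicInteraction v L (Fin.tail Z.1) + periodicInteraction v L (Fin.tail Z.2) +
          ∑ j : Fin n, (2 : ENNReal)⁻¹ * (periodizedPotential v L (Z.1 0 - Z.1 j.succ) +
            periodizedPotential v L (Z.2 0 - Z.2 j.succ) + periodizedPotential v L (Z.2 0 - Z.1 j.succ) +
            periodizedPotential v L (Z.1 0 - Z.2 j.succ))) * (‖Θ Z‖₊ : ENNReal) ^ 2)
    let Adm : (Config (n + 1) × Config (n + 1) → ℂ) → Prop := fun Θ => ContDiff ℝ 1 Θ ∧
      (∀ (Z : Config (n + 1) × Config (n + 1)) (i : Fin (n + 1)) (k : Fin 3),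
        Θ (Z.1 + Pi.single i (EuclideanSpace.single k L), Z.2) = Θ Z ∧
          Θ (Z.1, Z.2 + Pi.single i (EuclideanSpace.single k L)) = Θ Z) ∧
      ∫⁻ Z in C2, (‖Θ Z‖₊ : ENNReal) ^ 2 = 1
    let Θ : Config (n + 1) × Config (n + 1) → ℂ := fun Z => Ξ.ψ (Fin.append Z.1 Z.2)
    Adm Θ ∧ E2h Θ ≤ periodicEnergy v Ξ ∧ E2z Θ ≤ periodicEnergy v Ξ) →
    ∀ v : ℝ → ℝ≥0∞, IsRepulsiveFiniteRange v →
      ∃ ρ₀ : ℝ, 0 < ρ₀ ∧ ∀ ρ : ℝ, 0 < ρ → ρ < ρ₀ → ∀ᶠ n : ℕ in atTop,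
        let L : ℝ := sideLength ρ (n + 1)
        let C2 : Set (Config (n + 1) × Config (n + 1)) := (cellN (n + 1) L) ×ˢ (cellN (n + 1) L)
        let E2z : (Config (n + 1) × Config (n + 1) → ℂ) → ℝ≥0∞ := fun Θ => ∫⁻ Z in C2,
          kineticDensity (fun X => Θ (X, Z.2)) Z.1 + kineticDensity (fun Y => Θ (Z.1, Y)) Z.2 +
            (periodicInteraction v L Z.1 + periodicInteraction v L Z.2) * (‖Θ Z‖₊ : ENNReal) ^ 2
        let E2h : (Config (n + 1) × Config (n + 1) → ℂ) → ℝ≥0∞ := fun Θ => ∫⁻ Z in C2,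
          (kineticDensity (fun X => Θ (X, Z.2)) Z.1 + kineticDensity (fun Y => Θ (Z.1, Y)) Z.2 +
            (periodicInteraction v L (Fin.tail Z.1) + periodicInteraction v L (Fin.tail Z.2) +
              ∑ j : Fin n, (2 : ENNReal)⁻¹ * (periodizedPotential v L (Z.1 0 - Z.1 j.succ) +
                periodizedPotential v L (Z.2 0 - Z.2 j.succ) + periodizedPotential v L (Z.2 0 - Z.1 j.succ) +
                periodizedPotential v L (Z.1 0 - Z.2 j.succ))) * (‖Θ Z‖₊ : ENNReal) ^ 2)
        let Adm : (Config (n + 1) × Config (n + 1) → ℂ) → Prop := fun Θ => ContDiff ℝ 1 Θ ∧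
          (∀ (Z : Config (n + 1) × Config (n + 1)) (i : Fin (n + 1)) (k : Fin 3),
            Θ (Z.1 + Pi.single i (EuclideanSpace.single k L), Z.2) = Θ Z ∧
              Θ (Z.1, Z.2 + Pi.single i (EuclideanSpace.single k L)) = Θ Z) ∧
          ∫⁻ Z in C2, (‖Θ Z‖₊ : ENNReal) ^ 2 = 1
        let AdmS : (Config (n + 1) × Config (n + 1) → ℂ) → Prop := fun Θ => ContDiff ℝ 1 Θ ∧
          (∀ (Z : Config (n + 1) × Config (n + 1)) (i : Fin (n + 1)) (k : Fin 3),
            Θ (Z.1 + Pi.single i (EuclideanSpace.single k L), Z.2) = Θ Z ∧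
              Θ (Z.1, Z.2 + Pi.single i (EuclideanSpace.single k L)) = Θ Z) ∧
          (∀ X Y : Config (n + 1), Θ (Matrix.vecCons (Y 0) (Fin.tail X), Matrix.vecCons (X 0) (Fin.tail Y)) = Θ (X, Y)) ∧
          ∫⁻ Z in C2, (‖Θ Z‖₊ : ENNReal) ^ 2 = 1
        (⨅ (Θ' : Config (n + 1) × Config (n + 1) → ℂ) (_ : AdmS Θ'), E2h Θ') < ⊤ ∧
          (⨅ (Θ' : Config (n + 1) × Config (n + 1) → ℂ) (_ : Adm Θ'), E2h Θ') < ⊤ ∧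
          (⨅ (Θ' : Config (n + 1) × Config (n + 1) → ℂ) (_ : Adm Θ'), E2z Θ') < ⊤ ∧
          periodicGroundStateEnergy v (n + 1) L < ⊤

/-- Registered statement of `stub_hardCoreChordOfFrames`: S1c′ — the HARD-CORE chord GIVEN NON-VACUOUS FRAMES (XL / open;
held by the lead; promote candidate `HardCoreHalfSwapChord`): the frames statement of S5b implies the midpoint-chord overlap
claim for profiles unbounded on `[0, ∞)` (hard cores `⊤·1_{[0,a]}` included) — verbatim the former `stub_hardCoreChord`. -/
abbrev stub_hardCoreChordOfFrames : Prop :=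
  (∀ v : ℝ → ℝ≥0∞, IsRepulsiveFiniteRange v →
    ∃ ρ₀ : ℝ, 0 < ρ₀ ∧ ∀ ρ : ℝ, 0 < ρ → ρ < ρ₀ → ∀ᶠ n : ℕ in atTop,
      let L : ℝ := sideLength ρ (n + 1)
      let C2 : Set (Config (n + 1) × Config (n + 1)) := (cellN (n + 1) L) ×ˢ (cellN (n + 1) L)
      let E2z : (Config (n + 1) × Config (n + 1) → ℂ) → ℝ≥0∞ := fun Θ => ∫⁻ Z in C2,
        kineticDensity (fun X => Θ (X, Z.2)) Z.1 + kineticDensity (fun Y => Θ (Z.1, Y)) Z.2 +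
          (periodicInteraction v L Z.1 + periodicInteraction v L Z.2) * (‖Θ Z‖₊ : ENNReal) ^ 2
      let E2h : (Config (n + 1) × Config (n + 1) → ℂ) → ℝ≥0∞ := fun Θ => ∫⁻ Z in C2,
        (kineticDensity (fun X => Θ (X, Z.2)) Z.1 + kineticDensity (fun Y => Θ (Z.1, Y)) Z.2 +
          (periodicInteraction v L (Fin.tail Z.1) + periodicInteraction v L (Fin.tail Z.2) +
            ∑ j : Fin n, (2 : ENNReal)⁻¹ * (periodizedPotential v L (Z.1 0 - Z.1 j.succ) +
              periodizedPotential v L (Z.2 0 - Z.2 j.succ) + periodizedPotential v L (Z.2 0 - Z.1 j.succ) +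
              periodizedPotential v L (Z.1 0 - Z.2 j.succ))) * (‖Θ Z‖₊ : ENNReal) ^ 2)
      let Adm : (Config (n + 1) × Config (n + 1) → ℂ) → Prop := fun Θ => ContDiff ℝ 1 Θ ∧
        (∀ (Z : Config (n + 1) × Config (n + 1)) (i : Fin (n + 1)) (k : Fin 3),
          Θ (Z.1 + Pi.single i (EuclideanSpace.single k L), Z.2) = Θ Z ∧
            Θ (Z.1, Z.2 + Pi.single i (EuclideanSpace.single k L)) = Θ Z) ∧
        ∫⁻ Z in C2, (‖Θ Z‖₊ : ENNReal) ^ 2 = 1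
      let AdmS : (Config (n + 1) × Config (n + 1) → ℂ) → Prop := fun Θ => ContDiff ℝ 1 Θ ∧
        (∀ (Z : Config (n + 1) × Config (n + 1)) (i : Fin (n + 1)) (k : Fin 3),
          Θ (Z.1 + Pi.single i (EuclideanSpace.single k L), Z.2) = Θ Z ∧
            Θ (Z.1, Z.2 + Pi.single i (EuclideanSpace.single k L)) = Θ Z) ∧
        (∀ X Y : Config (n + 1), Θ (Matrix.vecCons (Y 0) (Fin.tail X), Matrix.vecCons (X 0) (Fin.tail Y)) = Θ (X, Y)) ∧
        ∫⁻ Z in C2, (‖Θ Z‖₊ : ENNReal) ^ 2 = 1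
      (⨅ (Θ' : Config (n + 1) × Config (n + 1) → ℂ) (_ : AdmS Θ'), E2h Θ') < ⊤ ∧
        (⨅ (Θ' : Config (n + 1) × Config (n + 1) → ℂ) (_ : Adm Θ'), E2h Θ') < ⊤ ∧
        (⨅ (Θ' : Config (n + 1) × Config (n + 1) → ℂ) (_ : Adm Θ'), E2z Θ') < ⊤ ∧
        periodicGroundStateEnergy v (n + 1) L < ⊤) →
    ∀ v : ℝ → ℝ≥0∞, IsRepulsiveFiniteRange v → (¬ ∃ M : NNReal, ∀ r, 0 ≤ r → v r ≤ M) →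
      ∃ ρ₀ : ℝ, 0 < ρ₀ ∧ ∀ ρ : ℝ, 0 < ρ → ρ < ρ₀ → ∃ η : ℝ, 0 < η ∧ ∀ᶠ n : ℕ in atTop,
        let L : ℝ := sideLength ρ (n + 1)
        let C2 : Set (Config (n + 1) × Config (n + 1)) := (cellN (n + 1) L) ×ˢ (cellN (n + 1) L)
        let E2z : (Config (n + 1) × Config (n + 1) → ℂ) → ℝ≥0∞ := fun Θ => ∫⁻ Z in C2,
          kineticDensity (fun X => Θ (X, Z.2)) Z.1 + kineticDensity (fun Y => Θ (Z.1, Y)) Z.2 +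
            (periodicInteraction v L Z.1 + periodicInteraction v L Z.2) * (‖Θ Z‖₊ : ENNReal) ^ 2
        let E2h : (Config (n + 1) × Config (n + 1) → ℂ) → ℝ≥0∞ := fun Θ => ∫⁻ Z in C2,
          (kineticDensity (fun X => Θ (X, Z.2)) Z.1 + kineticDensity (fun Y => Θ (Z.1, Y)) Z.2 +
            (periodicInteraction v L (Fin.tail Z.1) + periodicInteraction v L (Fin.tail Z.2) +
              ∑ j : Fin n, (2 : ENNReal)⁻¹ * (periodizedPotential v L (Z.1 0 - Z.1 j.succ) +
                periodizedPotential v L (Z.2 0 - Z.2 j.succ) + periodizedPotential v L (Z.2 0 - Z.1 j.succ) +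
                periodizedPotential v L (Z.1 0 - Z.2 j.succ))) * (‖Θ Z‖₊ : ENNReal) ^ 2)
        let Adm : (Config (n + 1) × Config (n + 1) → ℂ) → Prop := fun Θ => ContDiff ℝ 1 Θ ∧
          (∀ (Z : Config (n + 1) × Config (n + 1)) (i : Fin (n + 1)) (k : Fin 3),
            Θ (Z.1 + Pi.single i (EuclideanSpace.single k L), Z.2) = Θ Z ∧
              Θ (Z.1, Z.2 + Pi.single i (EuclideanSpace.single k L)) = Θ Z) ∧
          ∫⁻ Z in C2, (‖Θ Z‖₊ : ENNReal) ^ 2 = 1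
        ∃ δ : ℝ≥0∞, 0 < δ ∧ ∀ Φ Θ : Config (n + 1) × Config (n + 1) → ℂ,
          Adm Φ → E2z Φ ≤ (⨅ (Θ' : Config (n + 1) × Config (n + 1) → ℂ) (_ : Adm Θ'), E2z Θ') + δ →
          Adm Θ → E2h Θ ≤ (⨅ (Θ' : Config (n + 1) × Config (n + 1) → ℂ) (_ : Adm Θ'), E2h Θ') + δ →
          ENNReal.ofReal (1 / 2 + η) ≤ (‖∫ Z in C2, (starRingEnd ℂ) (Θ Z) * Φ Z‖₊ : ENNReal) ^ 2

/-- Registered statement of `stub_lowerFrame`: S6a — ENERGY ORDERING OF THE HALF-SWAP FRAMES (M, fixed `n`, all `v` incl.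
hard cores; folded `TwoCopyTorus` vocabulary of Theorems/BECSwapNoCatastropheDefs.lean): on the absolute class the half-swapped
form is bounded below by twice the one-copy bosonic ground-state energy, `2·E₀^per(n+1, L) ≤ E2(½)(Θ)`. Why true: pointwise the
`E2(½)`-integrand of `Θ` at `Z` is `½·(E2(0)-integrand of Θ at Z) + ½·(E2(0)-integrand of Θ at F Z with Θ∘F)` in `ℝ≥0∞`
(`½·⊤ = ⊤` included: `halfSwapWeight = ½·W₀ + ½·(W₀ ∘ F)` with `W₀ (X, Y) = periodicInteraction X + periodicInteraction Y`,
by `periodicInteraction_succ`; the kinetic part by `a = ½a + ½a`), then `le_lintegral_add` + `lintegral_const_mul'` (no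
measurability needed), the change of variables `SwapInvariance.setLIntegral_comp_swap` with `SwapInvariance.kinetic_comp`
(Theorems/…SwapInvariance.lean) turning the second integral into `E2(0)(Θ ∘ F)`, and the landed `TwoCopyTorus.productLower` for
`Θ` and for `Θ ∘ F ∈ Adm0` (`TwoCopyTorus.swapInvariance`): `½·2E₀ + ½·2E₀ = 2E₀`. -/
abbrev stub_lowerFrame : Prop :=
  ∀ v : ℝ → ℝ≥0∞, IsRepulsiveFiniteRange v → ∀ (n : ℕ) (L : ℝ) (Θ : Config (n + 1) × Config (n + 1) → ℂ),
    TwoCopyTorus.Adm0 n L Θ → 2 * periodicGroundStateEnergy v (n + 1) L ≤ TwoCopyTorus.E2half v n L Θ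

/-- Registered statement of `stub_upperFrameIntegrable`: S6b — THE HALF-SWAP DEFECT COSTS AT MOST FIRST-ORDER PERTURBATION
THEORY, UNIFORMLY IN `n` (L, fixed `n`, folded vocabulary): `inf_{Adm0} E2(½) ≤ 2·E₀^per(n+1, L) + n·L⁻³·∫_{ℝ³} v(|x|) dx`
(at `L = sideLength ρ (n+1)` the last term is `≤ ρ‖v‖₁`; vacuous when `∫ v = ∞` and `n ≥ 1`). Why true (translation
averaging): if `E₀^per = ⊤` there is nothing to show; else for a periodic `δ`-near-minimiser `Ψ` and `t ∈ ℝ³` the product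
`Θ_t (X, Y) = Ψ(X) · Ψ(Y − (t,…,t))` of `Ψ` with its translate (`PeriodicTrialState.exists_translate`, `periodicEnergy_translate`)
lies in `Adm0` with `E2(0)(Θ_t) ≤ periodicEnergy v Ψ + periodicEnergy v Ψ_t = 2·periodicEnergy v Ψ` (two-state version of the
landed `ProductUpper` computation); pointwise `halfSwapWeight ≤ (periodicInteraction X + periodicInteraction Y) +
½ Σⱼ [v^per(b − xⱼ) + v^per(a − yⱼ)]` (`periodicInteraction_succ`, `½ p ≤ p`), so `E2(½)(Θ_t) ≤ 2·periodicEnergy v Ψ + Cross(t)`;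
the CELL AVERAGE `L⁻³ ∫_{t ∈ [0,L)³} Cross(t) dt` is exactly `n·L⁻³·‖v‖_{L¹(ℝ³)}` (shift the `Y`-integral by `t` with
`PeriodicTrialState.lintegral_cellN_comp_sub`, then `∫_{[0,L)³} v^per(c − t) dt = ∫_{ℝ³} v(|x|) dx` by
`lintegral_cell_periodizedPotential_sub` + `periodizedPotential_neg`, Tonelli, `Ψ.norm_eq`), hence some `t` does not exceed the
average (first-moment method `MeasureTheory.exists_le_setLAverage` — needs `AEMeasurable (t ↦ Cross t)`, from
`Measurable.lintegral_prod_right'` — or by contradiction with `lintegral` monotonicity);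
finally `δ → 0` (`ENNReal.le_of_forall_pos_le_add` / `iInf` bookkeeping). -/
abbrev stub_upperFrameIntegrable : Prop :=
  ∀ v : ℝ → ℝ≥0∞, IsRepulsiveFiniteRange v → ∀ (n : ℕ) (L : ℝ), 0 < L →
    (⨅ (Θ : Config (n + 1) × Config (n + 1) → ℂ) (_ : TwoCopyTorus.Adm0 n L Θ), TwoCopyTorus.E2half v n L Θ) ≤
      2 * periodicGroundStateEnergy v (n + 1) L + (n : ℝ≥0∞) * (ENNReal.ofReal (L ^ 3))⁻¹ * ∫⁻ x : Space, v ‖x‖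

/-- Registered statement of `stub_hardCorePacking`: S7a — VOLUME PACKING IN `ℝ³` (M; worker): a finite `a`-separated set of
points inside a ball of radius `R` has at most `(1 + 2R/a)³` elements (the balls `B(x, a/2)` are disjoint and lie in `B(p, R + a/2)`;
compare Lebesgue volumes, `EuclideanSpace.volume_ball`). Used by S7 to bound the number of bath particles of one copy near a tagged
particle of the other copy on the support of a finite-energy hard-core state. -/
abbrev stub_hardCorePacking : Prop :=
  ∀ (a R : ℝ), 0 < a → 0 ≤ R → ∀ (s : Finset Space) (p : Space),
    (∀ x ∈ s, ∀ y ∈ s, x ≠ y → a ≤ ‖x - y‖) → (∀ x ∈ s, ‖x - p‖ ≤ R) →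
    (s.card : ℝ) ≤ (1 + 2 * R / a) ^ 3

/-- Registered statement of `stub_twoCopyIMS`: S7i — TWO-COPY IMS LOCALISATION WITH THE BOSONIC FLOOR (M/L; worker; folded
vocabulary): for a `C¹` periodic two-copy function `Θ` and a `C¹` periodic quadratic partition of unity `J₁² + J₂² = 1` (real),
`E2(0)(Θ J₁) + 2E₀^per · ‖Θ J₂‖² ≤ E2(0)(Θ) + ∫ |Θ|² (|∇J₁|² + |∇J₂|²)` (the gradient squares written as `kinetic2` of the real
`J`'s read in `ℂ`). Why true: POINTWISE IMS identity direction by direction — `|J₁∂Θ + Θ∂J₁|² + |J₂∂Θ + Θ∂J₂|² = |∂Θ|² +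
|Θ|²((∂J₁)² + (∂J₂)²)` because `J₁∂J₁ + J₂∂J₂ = ½∂(J₁² + J₂²) = 0` (product rule `fderiv_mul`, `HasFDerivAt.mul`, `Complex.ofRealCLM`)
— so `E2(0)(ΘJ₁) + E2(0)(ΘJ₂) = E2(0)(Θ) + ∫|Θ|²(…)` (`lintegral_add_left` with the measurable kinetic/potential integrands, cf.
`ProductUpper.measurable_energyDensity`, `HalfSwapTwoCopyForm.measurable_integrand`), and the mass-weighted bosonic floor
`2E₀‖ΘJ₂‖² ≤ E2(0)(ΘJ₂)` (`ProductLower.periodicGroundStateEnergy_mul_le_lintegral_sliceLeft` + `…sliceRight`, Theorems/…ProductLower.lean,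
for the `C¹` periodic `ΘJ₂`). This replaces the ground-state eigen-equation in the hard-core upper frame S7. -/
abbrev stub_twoCopyIMS : Prop :=
  ∀ v : ℝ → ℝ≥0∞, IsRepulsiveFiniteRange v → ∀ (n : ℕ) (L : ℝ) (Θ : Config (n + 1) × Config (n + 1) → ℂ)
    (J₁ J₂ : Config (n + 1) × Config (n + 1) → ℝ),
    ContDiff ℝ 1 Θ → TwoCopyTorus.IsPeriodic2 n L Θ → ContDiff ℝ 1 J₁ → ContDiff ℝ 1 J₂ →
    TwoCopyTorus.IsPeriodic2 n L (fun Z => (J₁ Z : ℂ)) → TwoCopyTorus.IsPeriodic2 n L (fun Z => (J₂ Z : ℂ)) →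
    (∀ Z, J₁ Z ^ 2 + J₂ Z ^ 2 = 1) →
    TwoCopyTorus.E2zero v n L (fun Z => Θ Z * (J₁ Z : ℂ)) +
        2 * periodicGroundStateEnergy v (n + 1) L *
          ∫⁻ Z in TwoCopyTorus.cell2 n L, (‖Θ Z * (J₂ Z : ℂ)‖₊ : ℝ≥0∞) ^ 2 ≤
      TwoCopyTorus.E2zero v n L Θ +
        ∫⁻ Z in TwoCopyTorus.cell2 n L, (‖Θ Z‖₊ : ℝ≥0∞) ^ 2 *
          (TwoCopyTorus.kinetic2 n (fun W => (J₁ W : ℂ)) Z + TwoCopyTorus.kinetic2 n (fun W => (J₂ W : ℂ)) Z)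

/-- Registered statement of `stub_upperFrameHardCore`: S7 — THE HARD-CORE UPPER FRAME, `O(1)` DEFECT UNIFORMLY IN `n` (XL; worker(s)):
for a profile with a hard core of radius `a > 0` (`v = ⊤` on `[0,a]`; range `R₀`), `inf_{Adm0} E2(½) ≤ 2E₀^per(n+1,L) + C(v)·n·L⁻³` for
`L ≥ L₀(v)` and `n ≤ c(v) L³` (at `L = sideLength ρ (n+1)`: `≤ 2E₀ + Cρ` for `ρ < c`, eventually). Hypotheses = S7a and S7i verbatim. Why true
(NO eigen-equation, no integration by parts): take a periodic near-minimiser `Ψ` (finite energy ⇒ `Ψ = 0` on the `a`-tubes,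
`periodizedPotential_eq_top_of_pairDist_le` + continuity), its translate `Ψ_t`, `Θ_t = Ψ ⊗ Ψ_t` (two-state product, `E2(0)(Θ_t) =
2·periodicEnergy v Ψ`), the smooth periodic CROSS cut-off `φ(Z) = Π_j f(a − y_j) f(b − x_j)` (`f = pairFactor L φ₀` of
Literature/…/PeriodicBoseGasJastrow.lean or the smooth profile of PeriodicSmoothPairCutoff.lean: `0` within torus distance `R₀ + δ′`, `1`
beyond `R₀ + 2δ′`), and the quadratic partition `J₁ = sin(π φ/2)`, `J₂ = cos(π φ/2)` (`J₁² + J₂² = 1`, both `C¹`, `J₁ = 0` where a cross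
pair is within range — so ALL cross interaction terms of `E2(½)` vanish on `Θ_t J₁` and its direct terms are `≤` those of `E2(0)` —,
`J₂ = 0` away from cross contacts). POINTWISE IMS: `kin(ΘJ₁) + kin(ΘJ₂) = kin Θ + |Θ|²(|∇J₁|² + |∇J₂|²)` (product rule; the cross term
is `Re(Θ̄∇Θ)·∇(J₁²+J₂²) = 0`), hence `E2(0)(Θ_tJ₁) + E2(0)(Θ_tJ₂) = E2(0)(Θ_t) + Num(t)`, `Num(t) = ∫|Θ_t|²(|∇J₁|²+|∇J₂|²) ≤ (π/2)²∫|Θ_t|²|∇φ|²`;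
the mass-weighted bosonic floor (`ProductLower.periodicGroundStateEnergy_mul_le_lintegral_sliceLeft/Right`: `2E₀‖Θ‖² ≤ E2(0)(Θ)` for
every `C¹` periodic `Θ`) applied to `Θ_tJ₂` gives `E2(0)(Θ_tJ₁) ≤ 2E₀‖Θ_tJ₁‖² + 2(E(Ψ) − E₀) + Num(t)` (all finite); `|∇φ|² ≤
(P + 1)·Σ_j (|∇f|²(a − y_j) + |∇f|²(b − x_j))` with `P` = number of bath particles within `R₀ + 2δ′` of the tagged one, `≤ (1 + 2(R₀+2δ′)/a)³`
by S7a on `supp Θ_t` (bath particles pairwise `≥ a` apart; nearest images via `reduce L`); translation AVERAGING over `t ∈ [0,L)³` (as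
in S6b: `PeriodicTrialState.lintegral_cellN_comp_sub`, `lintegral_cell_latSum_sub`/`lintegral_cell_periodizedPotential_sub`-type unfolding,
`Ψ.norm_eq`) gives `avg Num ≤ C₁ n L⁻³`, and for the mass deficit `Def(t) = ‖Θ_tJ₂‖² ≤ Σ_j ∫|Θ_t|²(1_B(a − y_j) + 1_B(b − x_j))`,
`avg Def ≤ C₂ n L⁻³`; ONE `t` with `Num(t)/avgNum + Def(t)/avgDef ≤ 2` exists (first moment, `MeasureTheory.exists_le_setLAverage` on
the cell, `volume_cell`); with `n ≤ cL³`, `Def ≤ ½`, normalise `Θ* = Θ_tJ₁/‖Θ_tJ₁‖ ∈ Adm0`: `E2(½)(Θ*) = E2(0)(Θ_tJ₁)/‖Θ_tJ₁‖² ≤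
2E₀ + 2(2(E(Ψ)−E₀) + 2C₁ n L⁻³)`; let `E(Ψ) → E₀`. Leans on: PeriodicBoseGasJastrow (`reduce`, `pairFactor`, `contDiff_pairFactor`,
`lintegral_cell_latSum_sub`, `lintegral_cellN_kernel_mul_le`), PeriodicHardCoreTube (`periodizedPotential_eq_top_of_pairDist_le`,
`periodizedPotential_eq_of_lt_pairDist`), ProductLower/ProductUpper/UpperFrameIntegrable lemmas of this line, Mathlib `Real.sin/cos` calculus. -/
abbrev stub_upperFrameHardCore : Prop :=
  (∀ (a R : ℝ), 0 < a → 0 ≤ R → ∀ (s : Finset Space) (p : Space),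
    (∀ x ∈ s, ∀ y ∈ s, x ≠ y → a ≤ ‖x - y‖) → (∀ x ∈ s, ‖x - p‖ ≤ R) →
    (s.card : ℝ) ≤ (1 + 2 * R / a) ^ 3) →
  (∀ v : ℝ → ℝ≥0∞, IsRepulsiveFiniteRange v → ∀ (n : ℕ) (L : ℝ) (Θ : Config (n + 1) × Config (n + 1) → ℂ)
    (J₁ J₂ : Config (n + 1) × Config (n + 1) → ℝ),
    ContDiff ℝ 1 Θ → TwoCopyTorus.IsPeriodic2 n L Θ → ContDiff ℝ 1 J₁ → ContDiff ℝ 1 J₂ →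
    TwoCopyTorus.IsPeriodic2 n L (fun Z => (J₁ Z : ℂ)) → TwoCopyTorus.IsPeriodic2 n L (fun Z => (J₂ Z : ℂ)) →
    (∀ Z, J₁ Z ^ 2 + J₂ Z ^ 2 = 1) →
    TwoCopyTorus.E2zero v n L (fun Z => Θ Z * (J₁ Z : ℂ)) +
        2 * periodicGroundStateEnergy v (n + 1) L *
          ∫⁻ Z in TwoCopyTorus.cell2 n L, (‖Θ Z * (J₂ Z : ℂ)‖₊ : ℝ≥0∞) ^ 2 ≤
      TwoCopyTorus.E2zero v n L Θ +
        ∫⁻ Z in TwoCopyTorus.cell2 n L, (‖Θ Z‖₊ : ℝ≥0∞) ^ 2 *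
          (TwoCopyTorus.kinetic2 n (fun W => (J₁ W : ℂ)) Z + TwoCopyTorus.kinetic2 n (fun W => (J₂ W : ℂ)) Z)) →
  ∀ v : ℝ → ℝ≥0∞, IsRepulsiveFiniteRange v → ∀ a : ℝ, 0 < a → (∀ r : ℝ, 0 ≤ r → r ≤ a → v r = ⊤) →
    ∃ C L₀ c : ℝ, 0 < c ∧ ∀ (n : ℕ) (L : ℝ), L₀ ≤ L → (n : ℝ) ≤ c * L ^ 3 →
      (⨅ (Θ : Config (n + 1) × Config (n + 1) → ℂ) (_ : TwoCopyTorus.Adm0 n L Θ), TwoCopyTorus.E2half v n L Θ) ≤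
        2 * periodicGroundStateEnergy v (n + 1) L + ENNReal.ofReal C * (n : ℝ≥0∞) * (ENNReal.ofReal (L ^ 3))⁻¹

/-- **The v6 frame pack** (NOT a stub: proved below as `framesV6` from S5b, S3a/S3b, S2b, S6a, S6b): for every repulsive
finite-range `v`, at small density and eventually in `n`, with `L = sideLength ρ (n+1)`: `E₀^per(n+1,L) < ⊤`,
`inf_{AdmSym} E2(½) = inf_{Adm0} E2(½) < ⊤`, `inf_{Adm0} E2(0) = 2E₀^per ≤ inf_{Adm0} E2(½) ≤ 2E₀^per + ρ·∫_{ℝ³} v`. This is the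
shared hypothesis text of the two open chord stubs S1e/S1f (inlined there verbatim). -/
abbrev FramesV6 : Prop :=
  ∀ v : ℝ → ℝ≥0∞, IsRepulsiveFiniteRange v →
    ∃ ρ₀ : ℝ, 0 < ρ₀ ∧ ∀ ρ : ℝ, 0 < ρ → ρ < ρ₀ → ∀ᶠ n : ℕ in atTop,
      periodicGroundStateEnergy v (n + 1) (sideLength ρ (n + 1)) < ⊤ ∧
      (⨅ (Θ : Config (n + 1) × Config (n + 1) → ℂ) (_ : TwoCopyTorus.AdmSym n (sideLength ρ (n + 1)) Θ),
          TwoCopyTorus.E2half v n (sideLength ρ (n + 1)) Θ) =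
        (⨅ (Θ : Config (n + 1) × Config (n + 1) → ℂ) (_ : TwoCopyTorus.Adm0 n (sideLength ρ (n + 1)) Θ),
          TwoCopyTorus.E2half v n (sideLength ρ (n + 1)) Θ) ∧
      (⨅ (Θ : Config (n + 1) × Config (n + 1) → ℂ) (_ : TwoCopyTorus.Adm0 n (sideLength ρ (n + 1)) Θ),
          TwoCopyTorus.E2half v n (sideLength ρ (n + 1)) Θ) < ⊤ ∧
      (⨅ (Θ : Config (n + 1) × Config (n + 1) → ℂ) (_ : TwoCopyTorus.Adm0 n (sideLength ρ (n + 1)) Θ),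
          TwoCopyTorus.E2zero v n (sideLength ρ (n + 1)) Θ) =
        2 * periodicGroundStateEnergy v (n + 1) (sideLength ρ (n + 1)) ∧
      2 * periodicGroundStateEnergy v (n + 1) (sideLength ρ (n + 1)) ≤
        (⨅ (Θ : Config (n + 1) × Config (n + 1) → ℂ) (_ : TwoCopyTorus.Adm0 n (sideLength ρ (n + 1)) Θ),
          TwoCopyTorus.E2half v n (sideLength ρ (n + 1)) Θ) ∧
      (⨅ (Θ : Config (n + 1) × Config (n + 1) → ℂ) (_ : TwoCopyTorus.Adm0 n (sideLength ρ (n + 1)) Θ),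
          TwoCopyTorus.E2half v n (sideLength ρ (n + 1)) Θ) ≤
        2 * periodicGroundStateEnergy v (n + 1) (sideLength ρ (n + 1)) + ENNReal.ofReal ρ * ∫⁻ x : Space, v ‖x‖

/-- Registered statement of `stub_pathRigidityOfIntegrable`: S0′ — RANK 3 ON THE INTEGRABLE SINGULAR CLASS (XL / open —
promote candidate; the honest content of the former S1e): `TorusSwapPathRigidity` (stmt-AtomisticToContinuum-14394) VERBATIM in the
folded vocabulary (`torusSwapPathRigidity_iff`), with its boundedness hypothesis `∃ M, ∀ r, v r ≤ M` replaced by "unbounded on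
`[0,∞)` but `∫_{ℝ³} v(|x|) dx < ∞`" (e.g. `r⁻¹·1_{r<R₀}`) — the class complementary to rank 3 inside the integrable profiles. For
such `v` the swap path `s ↦ E2(s)` is NON-degenerate (`v < ∞` a.e.), the first-order defect is finite (`≤ ρ‖v‖₁`, S6b) and the
fidelity-susceptibility count of rank 3 is unchanged (`v̂` bounded by `‖v‖₁`); the natural planner repair is to RESTATE rank 3 with
integrability in place of boundedness (one item covering both), after which this stub is that item by name. -/
abbrev stub_pathRigidityOfIntegrable : Prop :=
  ∀ v : ℝ → ℝ≥0∞, IsRepulsiveFiniteRange v → (¬ ∃ M : NNReal, ∀ r, 0 ≤ r → v r ≤ M) →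
    (∫⁻ x : Space, v ‖x‖) < ⊤ → ∀ ε : ℝ, 0 < ε →
    ∃ ρ₀ : ℝ, 0 < ρ₀ ∧ ∀ ρ : ℝ, 0 < ρ → ρ < ρ₀ → ∀ᶠ n : ℕ in atTop,
      ∀ s : ℝ, 0 ≤ s → s ≤ 1 → ∀ s' : ℝ, 0 ≤ s' → s' ≤ 1 → ∀ τ : ℝ, 0 < τ → ∃ δ : ℝ≥0∞, 0 < δ ∧
        ∀ Θ Θ' : Config (n + 1) × Config (n + 1) → ℂ,
          TwoCopyTorus.Adm0 n (sideLength ρ (n + 1)) Θ → TwoCopyTorus.Adm0 n (sideLength ρ (n + 1)) Θ' →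
          TwoCopyTorus.E2path v n (sideLength ρ (n + 1)) s Θ ≤
            (⨅ (Θ'' : Config (n + 1) × Config (n + 1) → ℂ) (_ : TwoCopyTorus.Adm0 n (sideLength ρ (n + 1)) Θ''),
              TwoCopyTorus.E2path v n (sideLength ρ (n + 1)) s Θ'') + δ →
          TwoCopyTorus.E2path v n (sideLength ρ (n + 1)) s' Θ' ≤
            (⨅ (Θ'' : Config (n + 1) × Config (n + 1) → ℂ) (_ : TwoCopyTorus.Adm0 n (sideLength ρ (n + 1)) Θ''),
              TwoCopyTorus.E2path v n (sideLength ρ (n + 1)) s' Θ'') + δ →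
          ENNReal.ofReal (1 - ε * (s - s') ^ 2 - τ) ≤
            (‖∫ Z in TwoCopyTorus.cell2 n (sideLength ρ (n + 1)), (starRingEnd ℂ) (Θ Z) * Θ' Z‖₊ : ENNReal) ^ 2

/-- Registered statement of `stub_integrableSingularChord`: S1e — GLUE (M; worker): rank 3 on the integrable singular class
(`stub_pathRigidityOfIntegrable`, hypothesis verbatim) ⇒ the midpoint chord `TwoCopyTorus.MidpointChordAt v` for every `v`
unbounded on `[0,∞)` with `∫ v < ∞` — the `(s, s′) = (½, 0)`, `ε = 1`, `τ = ⅛` instance after the identifications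
`E2path v n L (1/2) = E2half v n L` and `E2path v n L 0 = E2zero v n L` (`ChordOfPath.lintegral_half_eq` / `lintegral_zero_eq`,
Theorems/…ChordOfPath.lean, whose `stub_chordOfPath` is the same proof for the bounded class), `1 − ¼ − ⅛ = ½ + ⅛`. -/
abbrev stub_integrableSingularChord : Prop :=
  (∀ v : ℝ → ℝ≥0∞, IsRepulsiveFiniteRange v → (¬ ∃ M : NNReal, ∀ r, 0 ≤ r → v r ≤ M) →
    (∫⁻ x : Space, v ‖x‖) < ⊤ → ∀ ε : ℝ, 0 < ε →
    ∃ ρ₀ : ℝ, 0 < ρ₀ ∧ ∀ ρ : ℝ, 0 < ρ → ρ < ρ₀ → ∀ᶠ n : ℕ in atTop,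
      ∀ s : ℝ, 0 ≤ s → s ≤ 1 → ∀ s' : ℝ, 0 ≤ s' → s' ≤ 1 → ∀ τ : ℝ, 0 < τ → ∃ δ : ℝ≥0∞, 0 < δ ∧
        ∀ Θ Θ' : Config (n + 1) × Config (n + 1) → ℂ,
          TwoCopyTorus.Adm0 n (sideLength ρ (n + 1)) Θ → TwoCopyTorus.Adm0 n (sideLength ρ (n + 1)) Θ' →
          TwoCopyTorus.E2path v n (sideLength ρ (n + 1)) s Θ ≤
            (⨅ (Θ'' : Config (n + 1) × Config (n + 1) → ℂ) (_ : TwoCopyTorus.Adm0 n (sideLength ρ (n + 1)) Θ''),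
              TwoCopyTorus.E2path v n (sideLength ρ (n + 1)) s Θ'') + δ →
          TwoCopyTorus.E2path v n (sideLength ρ (n + 1)) s' Θ' ≤
            (⨅ (Θ'' : Config (n + 1) × Config (n + 1) → ℂ) (_ : TwoCopyTorus.Adm0 n (sideLength ρ (n + 1)) Θ''),
              TwoCopyTorus.E2path v n (sideLength ρ (n + 1)) s' Θ'') + δ →
          ENNReal.ofReal (1 - ε * (s - s') ^ 2 - τ) ≤
            (‖∫ Z in TwoCopyTorus.cell2 n (sideLength ρ (n + 1)), (starRingEnd ℂ) (Θ Z) * Θ' Z‖₊ : ENNReal) ^ 2) →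
  ∀ v : ℝ → ℝ≥0∞, IsRepulsiveFiniteRange v → (¬ ∃ M : NNReal, ∀ r, 0 ≤ r → v r ≤ M) →
    (∫⁻ x : Space, v ‖x‖) < ⊤ → TwoCopyTorus.MidpointChordAt v

/-- Registered statement of `stub_nonIntegrableChord`: S1f — the midpoint chord for NON-INTEGRABLE profiles
(`∫_{ℝ³} v(|x|) dx = ∞`: hard cores `⊤·1_{[0,a]}` and non-integrable singularities, all automatically unbounded on `[0,∞)`;
XL / open — held by the lead; promote candidate = the route's foreseen child `HardCoreHalfSwap`), GIVEN THE v6 FRAMES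
(hypothesis = `FramesV6` verbatim; its last conjunct is vacuous here). The path is DEGENERATE (`½·⊤ = ⊤`: for `0 < s < 1` every
`E2(s)` carries the full cross-copy exclusion while `E2(0)` does not), the product `Ψ ⊗ Ψ` has `E2(½) = ∞`, and no
differential / first-order argument exists: positivity (two-copy Feynman–Kac), a core-radius deformation, or Dyson softening
WITH an overlap-stability theorem are the candidate mechanisms; near-minimiser-wise the claim has the strength of torus BEC for
hard spheres. -/
abbrev stub_nonIntegrableChord : Prop :=
  (∀ v : ℝ → ℝ≥0∞, IsRepulsiveFiniteRange v →
    ∃ ρ₀ : ℝ, 0 < ρ₀ ∧ ∀ ρ : ℝ, 0 < ρ → ρ < ρ₀ → ∀ᶠ n : ℕ in atTop,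
      periodicGroundStateEnergy v (n + 1) (sideLength ρ (n + 1)) < ⊤ ∧
      (⨅ (Θ : Config (n + 1) × Config (n + 1) → ℂ) (_ : TwoCopyTorus.AdmSym n (sideLength ρ (n + 1)) Θ),
          TwoCopyTorus.E2half v n (sideLength ρ (n + 1)) Θ) =
        (⨅ (Θ : Config (n + 1) × Config (n + 1) → ℂ) (_ : TwoCopyTorus.Adm0 n (sideLength ρ (n + 1)) Θ),
          TwoCopyTorus.E2half v n (sideLength ρ (n + 1)) Θ) ∧
      (⨅ (Θ : Config (n + 1) × Config (n + 1) → ℂ) (_ : TwoCopyTorus.Adm0 n (sideLength ρ (n + 1)) Θ),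
          TwoCopyTorus.E2half v n (sideLength ρ (n + 1)) Θ) < ⊤ ∧
      (⨅ (Θ : Config (n + 1) × Config (n + 1) → ℂ) (_ : TwoCopyTorus.Adm0 n (sideLength ρ (n + 1)) Θ),
          TwoCopyTorus.E2zero v n (sideLength ρ (n + 1)) Θ) =
        2 * periodicGroundStateEnergy v (n + 1) (sideLength ρ (n + 1)) ∧
      2 * periodicGroundStateEnergy v (n + 1) (sideLength ρ (n + 1)) ≤
        (⨅ (Θ : Config (n + 1) × Config (n + 1) → ℂ) (_ : TwoCopyTorus.Adm0 n (sideLength ρ (n + 1)) Θ),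
          TwoCopyTorus.E2half v n (sideLength ρ (n + 1)) Θ) ∧
      (⨅ (Θ : Config (n + 1) × Config (n + 1) → ℂ) (_ : TwoCopyTorus.Adm0 n (sideLength ρ (n + 1)) Θ),
          TwoCopyTorus.E2half v n (sideLength ρ (n + 1)) Θ) ≤
        2 * periodicGroundStateEnergy v (n + 1) (sideLength ρ (n + 1)) + ENNReal.ofReal ρ * ∫⁻ x : Space, v ‖x‖) →
  (∀ v : ℝ → ℝ≥0∞, IsRepulsiveFiniteRange v → ∀ a : ℝ, 0 < a → (∀ r : ℝ, 0 ≤ r → r ≤ a → v r = ⊤) →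
    ∃ C L₀ c : ℝ, 0 < c ∧ ∀ (n : ℕ) (L : ℝ), L₀ ≤ L → (n : ℝ) ≤ c * L ^ 3 →
      (⨅ (Θ : Config (n + 1) × Config (n + 1) → ℂ) (_ : TwoCopyTorus.Adm0 n L Θ), TwoCopyTorus.E2half v n L Θ) ≤
        2 * periodicGroundStateEnergy v (n + 1) L + ENNReal.ofReal C * (n : ℝ≥0∞) * (ENNReal.ofReal (L ^ 3))⁻¹) →
  ∀ v : ℝ → ℝ≥0∞, IsRepulsiveFiniteRange v → (∫⁻ x : Space, v ‖x‖) = ⊤ → TwoCopyTorus.MidpointChordAt v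

/-- `Goal.stub_integrableSingularChord` is `stub_pathRigidityOfIntegrable → (integrable singular chord)` (definitional read-back). -/
theorem stub_integrableSingularChord_iff :
    stub_integrableSingularChord ↔
      (stub_pathRigidityOfIntegrable → ∀ v : ℝ → ℝ≥0∞, IsRepulsiveFiniteRange v →
        (¬ ∃ M : NNReal, ∀ r, 0 ≤ r → v r ≤ M) → (∫⁻ x : Space, v ‖x‖) < ⊤ → TwoCopyTorus.MidpointChordAt v) :=
  Iff.rfl

/-- `Goal.stub_nonIntegrableChord` is `FramesV6 → (S7 conclusion) → (non-integrable chord)` (definitional read-back). -/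
theorem stub_nonIntegrableChord_iff :
    stub_nonIntegrableChord ↔
      (FramesV6 → (∀ v : ℝ → ℝ≥0∞, IsRepulsiveFiniteRange v → ∀ a : ℝ, 0 < a → (∀ r : ℝ, 0 ≤ r → r ≤ a → v r = ⊤) →
          ∃ C L₀ c : ℝ, 0 < c ∧ ∀ (n : ℕ) (L : ℝ), L₀ ≤ L → (n : ℝ) ≤ c * L ^ 3 →
            (⨅ (Θ : Config (n + 1) × Config (n + 1) → ℂ) (_ : TwoCopyTorus.Adm0 n L Θ), TwoCopyTorus.E2half v n L Θ) ≤
              2 * periodicGroundStateEnergy v (n + 1) L + ENNReal.ofReal C * (n : ℝ≥0∞) * (ENNReal.ofReal (L ^ 3))⁻¹) →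
        ∀ v : ℝ → ℝ≥0∞, IsRepulsiveFiniteRange v → (∫⁻ x : Space, v ‖x‖) = ⊤ → TwoCopyTorus.MidpointChordAt v) :=
  Iff.rfl

/-- `Goal.stub_pathRigidity` is the folded `TorusSwapPathRigidity` (definitional read-back). -/
theorem stub_pathRigidity_iff : stub_pathRigidity ↔ TorusSwapPathRigidity :=
  Iff.rfl

/-- `Goal.stub_chordOfPath` is the folded `ChordOfPath` (definitional read-back). -/
theorem stub_chordOfPath_iff : stub_chordOfPath ↔ ChordOfPath :=
  Iff.rfl

/-- `Goal.stub_singularChord` is the folded `SingularChord` (definitional read-back). -/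
theorem stub_singularChord_iff : stub_singularChord ↔ SingularChord :=
  Iff.rfl

/-- `Goal.stub_swapInvariance` is the folded `SwapInvariance` (definitional read-back). -/
theorem stub_swapInvariance_iff : stub_swapInvariance ↔ SwapInvariance :=
  Iff.rfl

/-- `Goal.stub_symmetricInfimum` is the folded `SymmetricInfimumOfInvariance` (definitional read-back). -/
theorem stub_symmetricInfimum_iff : stub_symmetricInfimum ↔ SymmetricInfimumOfInvariance :=
  Iff.rfl

/-- `Goal.stub_productUpper` is the folded `ProductUpper` (definitional read-back). -/
theorem stub_productUpper_iff : stub_productUpper ↔ ProductUpper :=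
  Iff.rfl

/-- `Goal.stub_productLower` is the folded `ProductLower` (definitional read-back). -/
theorem stub_productLower_iff : stub_productLower ↔ ProductLower :=
  Iff.rfl

end Goal

/-! ## §4 Registered stubs (the only `sorry`s of this file; signatures = `Goal.stub_x` verbatim)

v6 (lead c6): registered = `stub_pathRigidity` (external), `stub_lowerFrame` (S6a, LANDED p160342 — imported), `stub_upperFrameIntegrable`
(S6b, LANDED p161479 — imported), `stub_hardCorePacking` (S7a, LANDED p162095 — imported), `stub_twoCopyIMS` (S7i, LANDED p163464 — imported), `stub_upperFrameHardCore` (S7, LANDED p166470 — imported), `stub_pathRigidityOfIntegrable` (S0′, open), `stub_integrableSingularChord` (S1e, glue, LANDED p161315 — imported), `stub_nonIntegrableChord` (S1f, open); `stub_hardCoreChordOfFrames` is retired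
(split into S1e/S1f, recovered as `hardCoreChord_of`). The composition's hypotheses are exactly the OPEN registered stubs; landed
ones enter as tree theorems.

v5 (lead c5): `stub_appendEmbedding` (S5a) and `stub_nonVacuity` (S5b) are LANDED (p157207 Theorems/…AppendEmbedding.lean,
p156992 Theorems/…NonVacuity.lean; imported above, same names/namespace), so the frames `hB hA` of the composition are now
tree theorems; the remaining `sorry`s are `stub_pathRigidity` (= stmt-AtomisticToContinuum-14394) and `stub_hardCoreChordOfFrames`.

v2 (lead c3, after wave 1): FIVE of the seven registered stubs are LANDED in the tree under these very names and this
namespace and are IMPORTED above — `stub_chordOfPath` (p147022, Theorems/BECSwapNoCatastropheTorusHalfSwapOverlapChordOfPath.lean),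
`stub_swapInvariance` (p147839, …SwapInvariance.lean), `stub_symmetricInfimum` (p151209, …SymmetricInfimum.lean, with the
Literature tool file `Literature/MathematicalPhysics/QuantumManyBody/HalfSwapTwoCopyForm.lean`, p150475), `stub_productUpper`
(p146983, …ProductUpper.lean), `stub_productLower` (p147137, …ProductLower.lean); v3: the fixed-`n` COMPOSITION NODE
`stub_cruxOfChord` (chord claim at `v` ⇒ crux at `v`) is LANDED too (p151950, …CruxOfChord.lean, with
`cruxAt_of_pathRigidity_of_bounded` and `torusHalfSwapOverlap_of_pathRigidity_of_singularChord`). The two remaining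
`sorry`s are the crux's real content: `stub_pathRigidity` (EXTERNAL = stmt-AtomisticToContinuum-14394, bounded `v`) and — v4 — the HARD-CORE chord
`stub_hardCoreChord` (profiles unbounded on `[0,∞)`), which replaces `stub_singularChord` through the glue `stub_singularOfHardCore`
(truncation to `[0,∞)` + rank 3; LANDED p152938, Theorems/…HardCoreReduction.lean, imported). -/

/-- S0 — EXTERNAL: rank 3 `TorusSwapPathRigidity` = stmt-AtomisticToContinuum-14394 BY NAME (open-problem; nobody in this line proves it). -/
theorem stub_pathRigidity :
    TorusSwapPathRigidity := by
  sorry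

-- S6a `stub_lowerFrame` is LANDED (lead c6 wave 1, p160342, Theorems/BECSwapNoCatastropheTorusHalfSwapOverlapLowerFrame.lean;
-- imported above under this very name/namespace), so its `sorry` is gone from this file.

-- S6b `stub_upperFrameIntegrable` is LANDED (lead c6 wave 1, p161479, Theorems/…UpperFrameIntegrable.lean; imported above).

/-- S0′ — `stub_pathRigidityOfIntegrable` (XL / open; promote candidate — "restate rank 3 with integrability"): rank 3
`TorusSwapPathRigidity` on the integrable singular class (unbounded on `[0,∞)`, `∫ v < ∞`). -/
theorem stub_pathRigidityOfIntegrable :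
    ∀ v : ℝ → ℝ≥0∞, IsRepulsiveFiniteRange v → (¬ ∃ M : NNReal, ∀ r, 0 ≤ r → v r ≤ M) →
      (∫⁻ x : Space, v ‖x‖) < ⊤ → ∀ ε : ℝ, 0 < ε →
      ∃ ρ₀ : ℝ, 0 < ρ₀ ∧ ∀ ρ : ℝ, 0 < ρ → ρ < ρ₀ → ∀ᶠ n : ℕ in atTop,
        ∀ s : ℝ, 0 ≤ s → s ≤ 1 → ∀ s' : ℝ, 0 ≤ s' → s' ≤ 1 → ∀ τ : ℝ, 0 < τ → ∃ δ : ℝ≥0∞, 0 < δ ∧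
          ∀ Θ Θ' : Config (n + 1) × Config (n + 1) → ℂ,
            TwoCopyTorus.Adm0 n (sideLength ρ (n + 1)) Θ → TwoCopyTorus.Adm0 n (sideLength ρ (n + 1)) Θ' →
            TwoCopyTorus.E2path v n (sideLength ρ (n + 1)) s Θ ≤
              (⨅ (Θ'' : Config (n + 1) × Config (n + 1) → ℂ) (_ : TwoCopyTorus.Adm0 n (sideLength ρ (n + 1)) Θ''),
                TwoCopyTorus.E2path v n (sideLength ρ (n + 1)) s Θ'') + δ →
            TwoCopyTorus.E2path v n (sideLength ρ (n + 1)) s' Θ' ≤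
              (⨅ (Θ'' : Config (n + 1) × Config (n + 1) → ℂ) (_ : TwoCopyTorus.Adm0 n (sideLength ρ (n + 1)) Θ''),
                TwoCopyTorus.E2path v n (sideLength ρ (n + 1)) s' Θ'') + δ →
            ENNReal.ofReal (1 - ε * (s - s') ^ 2 - τ) ≤
              (‖∫ Z in TwoCopyTorus.cell2 n (sideLength ρ (n + 1)), (starRingEnd ℂ) (Θ Z) * Θ' Z‖₊ : ENNReal) ^ 2 := by
  sorry

-- S1e `stub_integrableSingularChord` is LANDED (lead c6 wave 2, p161315, Theorems/…IntegrableSingularChord.lean; imported above).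

-- S7a `stub_hardCorePacking` is LANDED (lead c6 wave 3, p162095, Theorems/…HardCorePacking.lean; imported above).

-- S7i `stub_twoCopyIMS` is LANDED (lead c6 wave 3b, p163464, Theorems/…TwoCopyIMS.lean; imported above).

-- S7 `stub_upperFrameHardCore` is LANDED (lead c6 wave 3c, p166470 with helper files p165522 p165597 p165919;
-- Theorems/…UpperFrameHardCore{Cutoff,Support,Pointwise,}.lean; imported above).

/-- S1f — `stub_nonIntegrableChord` (XL / open; held by the lead; promote candidate = the route's child `HardCoreHalfSwap`):
the v6 frames ⇒ the midpoint chord for NON-INTEGRABLE profiles (`∫_{ℝ³} v = ∞`: hard cores; the degenerate path). -/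
theorem stub_nonIntegrableChord :
    (∀ v : ℝ → ℝ≥0∞, IsRepulsiveFiniteRange v →
      ∃ ρ₀ : ℝ, 0 < ρ₀ ∧ ∀ ρ : ℝ, 0 < ρ → ρ < ρ₀ → ∀ᶠ n : ℕ in atTop,
        periodicGroundStateEnergy v (n + 1) (sideLength ρ (n + 1)) < ⊤ ∧
        (⨅ (Θ : Config (n + 1) × Config (n + 1) → ℂ) (_ : TwoCopyTorus.AdmSym n (sideLength ρ (n + 1)) Θ),
            TwoCopyTorus.E2half v n (sideLength ρ (n + 1)) Θ) =
          (⨅ (Θ : Config (n + 1) × Config (n + 1) → ℂ) (_ : TwoCopyTorus.Adm0 n (sideLength ρ (n + 1)) Θ),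
            TwoCopyTorus.E2half v n (sideLength ρ (n + 1)) Θ) ∧
        (⨅ (Θ : Config (n + 1) × Config (n + 1) → ℂ) (_ : TwoCopyTorus.Adm0 n (sideLength ρ (n + 1)) Θ),
            TwoCopyTorus.E2half v n (sideLength ρ (n + 1)) Θ) < ⊤ ∧
        (⨅ (Θ : Config (n + 1) × Config (n + 1) → ℂ) (_ : TwoCopyTorus.Adm0 n (sideLength ρ (n + 1)) Θ),
            TwoCopyTorus.E2zero v n (sideLength ρ (n + 1)) Θ) =
          2 * periodicGroundStateEnergy v (n + 1) (sideLength ρ (n + 1)) ∧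
        2 * periodicGroundStateEnergy v (n + 1) (sideLength ρ (n + 1)) ≤
          (⨅ (Θ : Config (n + 1) × Config (n + 1) → ℂ) (_ : TwoCopyTorus.Adm0 n (sideLength ρ (n + 1)) Θ),
            TwoCopyTorus.E2half v n (sideLength ρ (n + 1)) Θ) ∧
        (⨅ (Θ : Config (n + 1) × Config (n + 1) → ℂ) (_ : TwoCopyTorus.Adm0 n (sideLength ρ (n + 1)) Θ),
            TwoCopyTorus.E2half v n (sideLength ρ (n + 1)) Θ) ≤
          2 * periodicGroundStateEnergy v (n + 1) (sideLength ρ (n + 1)) + ENNReal.ofReal ρ * ∫⁻ x : Space, v ‖x‖) →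
    (∀ v : ℝ → ℝ≥0∞, IsRepulsiveFiniteRange v → ∀ a : ℝ, 0 < a → (∀ r : ℝ, 0 ≤ r → r ≤ a → v r = ⊤) →
      ∃ C L₀ c : ℝ, 0 < c ∧ ∀ (n : ℕ) (L : ℝ), L₀ ≤ L → (n : ℝ) ≤ c * L ^ 3 →
        (⨅ (Θ : Config (n + 1) × Config (n + 1) → ℂ) (_ : TwoCopyTorus.Adm0 n L Θ), TwoCopyTorus.E2half v n L Θ) ≤
          2 * periodicGroundStateEnergy v (n + 1) L + ENNReal.ofReal C * (n : ℝ≥0∞) * (ENNReal.ofReal (L ^ 3))⁻¹) →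
    ∀ v : ℝ → ℝ≥0∞, IsRepulsiveFiniteRange v → (∫⁻ x : Space, v ‖x‖) = ⊤ → TwoCopyTorus.MidpointChordAt v := by
  sorry

/-! ## §5 Composition (sorry-free): the crux BY NAME from the stubs

v6 (lead c6): hypotheses = the registered OPEN stub statements `Goal.stub_pathRigidity` (external, stmt-14394),
`Goal.stub_pathRigidityOfIntegrable` (S0′) and `Goal.stub_nonIntegrableChord` (S1f), the glue `Goal.stub_integrableSingularChord` (S1e),
plus the wave stubs `Goal.stub_lowerFrame` (S6a, landed: enters as a tree theorem) and `Goal.stub_upperFrameIntegrable` (S6b) which, with the LANDED S5b/S5a (`stub_nonVacuity stub_appendEmbedding`,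
p156992, p157207), S2a/S2b (`TwoCopyTorus.symmetricInfimumAll`) and S3a/S3b (`TwoCopyTorus.productUpper/productLower`), give the
frame pack `framesV6_of`; the hard-core chord `Goal.stub_hardCoreChord` is recovered by cases on integrability
(`hardCoreChord_of`) and fed to the landed node `torusHalfSwapOverlap_of_pathRigidity_of_hardCoreChord`. -/

/-- At `L = sideLength ρ (n+1)` the first-order constant `n·L⁻³` is at most the density: `n / L³ = n ρ/(n+1) ≤ ρ`. [folklore] -/
theorem natCast_mul_inv_sideLength_cube_le {ρ : ℝ} (hρ : 0 < ρ) (n : ℕ) :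
    (n : ℝ≥0∞) * (ENNReal.ofReal (sideLength ρ (n + 1) ^ 3))⁻¹ ≤ ENNReal.ofReal ρ := by
  have hN : (0 : ℝ) < (n : ℝ) + 1 := by positivity
  have hq : (0 : ℝ) < ((n : ℝ) + 1) / ρ := by positivity
  have hL3 : sideLength ρ (n + 1) ^ 3 = ((n : ℝ) + 1) / ρ := by
    have h := Real.rpow_inv_natCast_pow hq.le (n := 3) (by norm_num)
    have h3 : ((3 : ℕ) : ℝ)⁻¹ = (1 / 3 : ℝ) := by norm_num
    rw [h3] at h
    simpa [sideLength, Nat.cast_add, Nat.cast_one] using h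
  rw [hL3, ← ENNReal.ofReal_inv_of_pos hq, inv_div, ← ENNReal.ofReal_natCast,
    ← ENNReal.ofReal_mul (Nat.cast_nonneg n)]
  refine ENNReal.ofReal_le_ofReal ?_
  rw [mul_div_assoc', div_le_iff₀ hN]
  nlinarith

/-- **The v6 frame pack from the landed stubs and the two wave stubs** (S5b/S5a non-vacuity, S2 symmetric infimum, S3 product
bounds, S6a lower frame, S6b upper frame; `n·L⁻³ ≤ ρ`). [folklore] -/
theorem framesV6_of (hLF : Goal.stub_lowerFrame) (hUF : Goal.stub_upperFrameIntegrable) : Goal.FramesV6 := by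
  intro v hv
  have hB : Goal.stub_nonVacuity := stub_nonVacuity
  obtain ⟨ρ₁, hρ₁, H⟩ := hB stub_appendEmbedding v hv
  refine ⟨ρ₁, hρ₁, fun ρ hρ hρlt => ?_⟩
  filter_upwards [H ρ hρ hρlt] with n hn
  obtain ⟨hS, hH, hZ, hE⟩ := hn
  set L : ℝ := sideLength ρ (n + 1) with hL
  have hLpos : 0 < L := by
    rw [hL]; unfold sideLength; positivity
  -- folded read-backs of the unfolded non-vacuity conjuncts (definitional)
  have hH' : (⨅ (Θ : Config (n + 1) × Config (n + 1) → ℂ) (_ : TwoCopyTorus.Adm0 n L Θ), TwoCopyTorus.E2half v n L Θ) < ⊤ :=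
    hH
  -- symmetric infimum = absolute infimum (landed S2a/S2b)
  have hsym : (⨅ (Θ : Config (n + 1) × Config (n + 1) → ℂ) (_ : TwoCopyTorus.AdmSym n L Θ), TwoCopyTorus.E2half v n L Θ) =
      ⨅ (Θ : Config (n + 1) × Config (n + 1) → ℂ) (_ : TwoCopyTorus.Adm0 n L Θ), TwoCopyTorus.E2half v n L Θ :=
    TwoCopyTorus.symmetricInfimumAll v hv n L
  -- the uncoupled frame is exactly `2E₀` (landed S3a/S3b)
  have hzero : (⨅ (Θ : Config (n + 1) × Config (n + 1) → ℂ) (_ : TwoCopyTorus.Adm0 n L Θ), TwoCopyTorus.E2zero v n L Θ) =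
      2 * periodicGroundStateEnergy v (n + 1) L := by
    refine le_antisymm ?_ (le_iInf₂ fun Θ hΘ => TwoCopyTorus.productLower v hv n L Θ hΘ)
    rw [periodicGroundStateEnergy, ENNReal.mul_iInf_of_ne two_ne_zero ENNReal.ofNat_ne_top]
    refine le_iInf fun Ψ => ?_
    obtain ⟨hadm, hle⟩ := TwoCopyTorus.productUpper v hv n L Ψ
    exact (iInf₂_le _ hadm).trans hle
  -- ordering (S6a) and tightness (S6b, `n L⁻³ ≤ ρ`)
  have hlow : 2 * periodicGroundStateEnergy v (n + 1) L ≤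
      ⨅ (Θ : Config (n + 1) × Config (n + 1) → ℂ) (_ : TwoCopyTorus.Adm0 n L Θ), TwoCopyTorus.E2half v n L Θ :=
    le_iInf₂ fun Θ hΘ => hLF v hv n L Θ hΘ
  have hup : (⨅ (Θ : Config (n + 1) × Config (n + 1) → ℂ) (_ : TwoCopyTorus.Adm0 n L Θ), TwoCopyTorus.E2half v n L Θ) ≤
      2 * periodicGroundStateEnergy v (n + 1) L + ENNReal.ofReal ρ * ∫⁻ x : Space, v ‖x‖ := by
    refine (hUF v hv n L hLpos).trans (add_le_add le_rfl ?_)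
    have hc := natCast_mul_inv_sideLength_cube_le hρ n
    gcongr
  exact ⟨hE, hsym, hH', hzero, hlow, hup⟩

/-- **The hard-core chord (v4 `Goal.stub_hardCoreChord`, unfolded) from the two v6 open stubs**, by cases on integrability of
`v`, the frames being supplied by `framesV6_of`; the folded `TwoCopyTorus.MidpointChordAt v` is read back definitionally. [folklore] -/
theorem hardCoreChord_of (hLF : Goal.stub_lowerFrame) (hUF : Goal.stub_upperFrameIntegrable)
    (hPI : Goal.stub_pathRigidityOfIntegrable) (hI : Goal.stub_integrableSingularChord)
    (hPk : Goal.stub_hardCorePacking) (hIMS : Goal.stub_twoCopyIMS) (hU7 : Goal.stub_upperFrameHardCore)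
    (hN : Goal.stub_nonIntegrableChord) : Goal.stub_hardCoreChord := by
  have hF : Goal.FramesV6 := framesV6_of hLF hUF
  intro v hv hub
  have key : TwoCopyTorus.MidpointChordAt v := by
    by_cases hint : (∫⁻ x : Space, v ‖x‖) < ⊤
    · exact hI hPI v hv hub hint
    · exact hN hF (hU7 hPk hIMS) v hv (not_lt_top_iff.mp hint)
  exact key

/-- **The crux from the stubs — v6** (hypotheses = the five registered stub statements by their audit names: the external
rank 3, the two wave stubs S6a/S6b, and the two OPEN chord halves S1e/S1f; conclusion = the route decl
`Theses.BECSwapNoCatastrophe.TorusHalfSwapOverlap` BY NAME), through `hardCoreChord_of` and the LANDED composition node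
`torusHalfSwapOverlap_of_pathRigidity_of_hardCoreChord` (Theorems/…HardCoreReduction.lean). [folklore] -/
theorem TorusHalfSwapOverlap_of (h0 : Goal.stub_pathRigidity) (hPI : Goal.stub_pathRigidityOfIntegrable)
    (hN : Goal.stub_nonIntegrableChord) : TorusHalfSwapOverlap :=
  -- S6a `stub_lowerFrame` (p160342), S6b `stub_upperFrameIntegrable` (p161479), S1e `stub_integrableSingularChord` (p161315),
  -- S7a `stub_hardCorePacking` (p162095), S7i `stub_twoCopyIMS` (p163464) and S7 `stub_upperFrameHardCore` (p166470) are LANDED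
  -- and enter as tree theorems: the hypotheses are exactly the three OPEN statements
  torusHalfSwapOverlap_of_pathRigidity_of_hardCoreChord h0
    (hardCoreChord_of stub_lowerFrame stub_upperFrameIntegrable hPI stub_integrableSingularChord
      stub_hardCorePacking stub_twoCopyIMS stub_upperFrameHardCore hN)

/-- **The crux from rank 3 and the singular chord, directly through the folded vocabulary** (the v2 composition,
kept as a cross-check: closure modulo the open stubs without the composition node). [folklore] -/
theorem TorusHalfSwapOverlap_of' (h0 : Goal.stub_pathRigidity) (hPI : Goal.stub_pathRigidityOfIntegrable)
    (hN : Goal.stub_nonIntegrableChord) :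
    TorusHalfSwapOverlap := by
  -- S6a (p160342), S6b (p161479), S1e (p161315), S7a (p162095), S7i (p163464) and S7 (p166470) are LANDED: tree theorems, read back definitionally
  have hLF : Goal.stub_lowerFrame := stub_lowerFrame
  have hPk : Goal.stub_hardCorePacking := stub_hardCorePacking
  have hIMS : Goal.stub_twoCopyIMS := stub_twoCopyIMS
  have hU7 : Goal.stub_upperFrameHardCore := stub_upperFrameHardCore
  have hUF : Goal.stub_upperFrameIntegrable := stub_upperFrameIntegrable
  have hI : Goal.stub_integrableSingularChord := stub_integrableSingularChord
  have hHC : Goal.stub_hardCoreChord := hardCoreChord_of hLF hUF hPI hI hPk hIMS hU7 hN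
  have h1b : Goal.stub_singularChord := stub_singularOfHardCore h0 hHC
  -- the five LANDED stubs (imported Theorems files, same names/namespace) and the two registered hypotheses,
  -- read back as the folded statements of §2 (definitional, `Goal.stub_x_iff`)
  have g1 : ChordOfPath := Goal.stub_chordOfPath_iff.mp stub_chordOfPath
  have g1b : SingularChord := Goal.stub_singularChord_iff.mp h1b
  have g2a : SwapInvariance := Goal.stub_swapInvariance_iff.mp stub_swapInvariance
  have g2b : SymmetricInfimumOfInvariance := Goal.stub_symmetricInfimum_iff.mp stub_symmetricInfimum
  have g3a : ProductUpper := Goal.stub_productUpper_iff.mp stub_productUpper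
  have g3b : ProductLower := Goal.stub_productLower_iff.mp stub_productLower
  refine torusHalfSwapOverlap_iff.mpr ?_
  intro v hv
  obtain ⟨ρ₁, hρ₁, H1⟩ := midpointChordAt_of (g1 h0) g1b v hv
  refine ⟨ρ₁, hρ₁, fun ρ hρ hρlt => ?_⟩
  obtain ⟨η, hη, hev1⟩ := H1 ρ hρ hρlt
  refine ⟨η, hη, ?_⟩
  filter_upwards [hev1] with n hn1
  obtain ⟨δ, hδ, hmain⟩ := hn1
  set L : ℝ := sideLength ρ (n + 1) with hL
  refine ⟨δ / 2, ENNReal.half_pos hδ.ne', fun Ψ hΨ Θ hΘ hΘmin => ?_⟩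
  obtain ⟨hΦadm, hΦle⟩ := g3a v hv n L Ψ
  have h2δ : (2 : ℝ≥0∞) * (δ / 2) = δ := ENNReal.mul_div_cancel two_ne_zero ENNReal.ofNat_ne_top
  -- `Ψ ⊗ Ψ` is an absolute `δ`-near-minimiser of `E2(0)`
  have hΦmin : E2zero v n L (fun Z => Ψ.ψ Z.1 * Ψ.ψ Z.2) ≤
      (⨅ (Θ' : Config2 n → ℂ) (_ : Adm0 n L Θ'), E2zero v n L Θ') + δ := by
    have hlow : 2 * periodicGroundStateEnergy v (n + 1) L ≤
        ⨅ (Θ' : Config2 n → ℂ) (_ : Adm0 n L Θ'), E2zero v n L Θ' :=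
      le_iInf₂ fun Θ' hΘ' => g3b v hv n L Θ' hΘ'
    calc E2zero v n L (fun Z => Ψ.ψ Z.1 * Ψ.ψ Z.2)
        ≤ 2 * periodicEnergy v Ψ := hΦle
      _ ≤ 2 * (periodicGroundStateEnergy v (n + 1) L + δ / 2) := by gcongr
      _ = 2 * periodicGroundStateEnergy v (n + 1) L + δ := by rw [mul_add, h2δ]
      _ ≤ (⨅ (Θ' : Config2 n → ℂ) (_ : Adm0 n L Θ'), E2zero v n L Θ') + δ := add_le_add hlow le_rfl
  -- the crux's `Θ` is an absolute `δ`-near-minimiser of `E2(½)`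
  have hinf : (⨅ (Θ' : Config2 n → ℂ) (_ : AdmSym n L Θ'), E2half v n L Θ') =
      ⨅ (Θ' : Config2 n → ℂ) (_ : Adm0 n L Θ'), E2half v n L Θ' := g2b g2a v hv n L
  have hΘmin' : E2half v n L Θ ≤ (⨅ (Θ' : Config2 n → ℂ) (_ : Adm0 n L Θ'), E2half v n L Θ') + δ := by
    calc E2half v n L Θ
        ≤ (⨅ (Θ' : Config2 n → ℂ) (_ : AdmSym n L Θ'), E2half v n L Θ') + δ / 2 := hΘmin
      _ = (⨅ (Θ' : Config2 n → ℂ) (_ : Adm0 n L Θ'), E2half v n L Θ') + δ / 2 := by rw [hinf]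
      _ ≤ (⨅ (Θ' : Config2 n → ℂ) (_ : Adm0 n L Θ'), E2half v n L Θ') + δ :=
          add_le_add le_rfl ENNReal.half_le_self
  exact hmain (fun Z => Ψ.ψ Z.1 * Ψ.ψ Z.2) Θ hΦadm hΦmin hΘ.adm0 hΘmin'

end Summit.AtomisticToContinuum.BoseEinsteinCondensation.Cruxes.TorusHalfSwapOverlap.Birth

end
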